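import Literature.MathematicalPhysics.QuantumLattice.FermiRG.BGM2006Sec2FrameBridge
import Literature.MathematicalPhysics.QuantumLattice.AnisotropicSectorSupport
import Literature.MathematicalPhysics.QuantumLattice.HubbardFermiPolar
import Literature.MathematicalPhysics.QuantumLattice.SectorSymbolMasterZero
import Literature.MathematicalPhysics.QuantumLattice.HubbardUmklappKinematics
import Mathlib.Analysis.Calculus.ImplicitContDiff
import Mathlib.Analysis.Convex.Deriv
import Mathlib.Analysis.SpecialFunctions.Trigonometric.Bounds
import HarnessLib

/-!
# Benfatto–Giuliani–Mastropietro 2006, Lemma 2.1 — PROOF (discharge of `BGM2006_Lemma_2_1`)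

Companion proof file of `BGM2006Sec2Setup.lean` (typer-wave file F1a of the cell `gate-hubbard-kl`;
source BGM06 = G. Benfatto, A. Giuliani, V. Mastropietro, *Fermi liquid behavior in the 2D Hubbard model
at low temperatures*, Ann. Henri Poincaré **7** (2006) 809–898, arXiv:cond-mat/0507686, §2.4; locators
`p00NN:Lnn` = chunk/line of the `lit read` render of the arXiv TeX).  The statement file declares
Lemma 2.1 as the named fact `BGM2006_Lemma_2_1 : Prop` (FACT-LIST F-001); this file PROVES it,
`theorem BGM2006_Lemma_2_1_holds : BGM2006_Lemma_2_1`, leaving the statement file untouched.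

## The printed proof and how it is followed

BGM (p0009:L77–L99): "Given `h_β ≤ h ≤ 0`, we can write `ε_h = ε_0 + Σ_{j=h+1}^0 (ε_{j-1} - ε_j)`.  From this
identity and the inductive assumption (2.36) we soon find
`|ε_h - ε_0| ≤ C₀|U|Σ|j|γ^{2j} ≤ C₀'|U|`, `|∇ε_h - ∇ε_0| ≤ 2C₁U²Σγ^j|j| ≤ C₁'U²`,
`|∂²ε_h - ∂²ε_0| ≤ C₂U²Σ|j| ≤ C₂c₀²` (2.41a) … the equation `ε_h(k⃗) - μ = e` can be inverted … (implicit
function Theorem) … the third bound in (2.41a) implies that the second derivatives of `ε_h` are close to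
the second derivatives of `ε_0` … this means that `Σ^{(h)}(e)` is convex … because the curvature radius is
computed in terms of the first two derivatives of `ε_h`."  Accordingly:

* §A (abstract, any `ε : ℝ² → ℝ` that is `C²`-close to the free band `ε₀ = sqDispersion`):
  §A1 `cos k₁ + cos k₂ ≤ 1 + cos |k⃗|` (convexity of `a ↦ cos √a`, from the secant monotonicity of the
  concave `sin` on `[0, π]`), whence the EUCLIDEAN radius bound `|k⃗| ≤ K(L) = arccos(-L/2 - 1)` on
  `{ε₀ ≤ L}` (BGM's Remark after (2.39), "`8 arccos(1 - μ - e₀) < 2π`"); §A2 the frame `e⃗_r, e⃗_t`, the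
  radial/tangential derivatives of `ε₀` along rays (`4t/π ≤ ∇ε₀·e⃗_r ≤ 2t`), and the Hessian
  `D²ε₀ = 2 diag(cos k₁, cos k₂)`; §A3 existence (intermediate values, `exists_exit` of
  `HubbardFermiRadius`) and uniqueness (radial strict monotonicity) of the ray root on `[0, π/2]`, so that
  `levelRadius` IS the root; §A4 the implicit function theorem (`ContDiffAt.implicitFunction`, as in the
  tree's `contDiffAt_bandFermiRadius_uncurry`) ⇒ `(lev, θ) ↦ u` is `Cⁿ` jointly, `θ ↦ u(θ, e)` is `Cⁿ`;
  §A5 the chain rule once (`∇ε·p⃗' = 0`) and twice (`D²ε(p⃗',p⃗') + ∇ε·p⃗'' = 0`) along the polar curve and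
  the resulting formula `polarCurvature = u·D²ε(p⃗',p⃗')/((∇ε·e⃗_r)|p⃗'|³) ≥ λ/M`; §A6 the triangle
  inequality for the Euclidean norm of a sum of plane vectors.
* §B the instantiation `ε = ε_h = bgmEffDisp β E h`: telescoping, the three bounds of (2.41a) read off
  `BGMSmoothness` through `mixedPartial`/`iteratedFDeriv` algebra, with the elementary sums
  `Σ m4^{-m}, Σ m4^{-2m} ≤ 2` and `Σ_{m<|h|} m ≤ h²` (the latter is where `c₀ = |h_β|U₀` enters).
* §C the assembly with explicit constants: `ē = e₀/2`, `c = min(√e₀/2, 1/5)`,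
  `c₁ = (4/π)(√e₀/2) - 4|C₁|c₀²`, `c₂ = 5`,
  `c₀ = min(1, e₀/(16(|C₀|+1)), √e₀/(8(|C₁|+1)), 1/(8(|C₂|+1)))`.

Deviations from print, all on the safe side: the constants are explicit rather than "`c⁰/2`, …"; the
curvature bound is derived from the uniform strong convexity `Hess ε_h ≥ 1` on the disc `|kᵢ| ≤ π/4`
containing every curve (rather than by continuity from `r_0`); the umklapp clause (2.40a) is proved from the
Euclidean radius bound `|k⃗| < π/4` (BGM's footnote computation).  Tree inputs: `levelRadius`,
`IsLevelRadius`, `polarCurvature`, `bgmEffDisp`, `BGMSmoothness` (F1a), `levelRadius_bgmEffDisp_add_pi`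
(FrameBridge), `polar_repr`, `hasDerivAt_dir`, `fderiv_sqDispersion_apply`, `contDiff_sqDispersion`,
`exists_exit`, `umklappRadius`, `abs_le_arccos_of_le_cos`.

Everything is proved; no definitions, no named facts, no `sorry`, no axioms beyond the standard three,
no instances, no notation.

## Sources

* [BGM06] G. Benfatto, A. Giuliani, V. Mastropietro, Ann. Henri Poincaré 7 (2006) 809–898,
  arXiv:cond-mat/0507686, §2.4 Lemma 2.1 and its proof. [BenfattoGiulianiMastropietro2006]
-/

noncomputable section

open Real Set Filter
open scoped Topology

namespace Literature.MathematicalPhysics.QuantumLattice.FermiRG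

/-! ### §A1 Trigonometric preliminaries: `sin x / x` decreases, `a ↦ cos √a` is convex,
`cos x + cos y ≤ 1 + cos |(x, y)|` -/

/-- `sin y / y ≤ sin x / x` for `0 < x ≤ y ≤ π` (concavity of `sin` on `[0, π]`, `sin 0 = 0`). [folklore] -/
private theorem sin_div_le_sin_div {x y : ℝ} (hx : 0 < x) (hxy : x ≤ y) (hy : y ≤ π) :
    Real.sin y / y ≤ Real.sin x / x := by
  have hconv : ConvexOn ℝ (Icc 0 π) (fun t => -Real.sin t) := (strictConcaveOn_sin_Icc.concaveOn).neg
  have hy0 : 0 < y := hx.trans_le hxy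
  have h := hconv.secant_mono (a := 0) (x := x) (y := y) ⟨le_rfl, Real.pi_pos.le⟩
    ⟨hx.le, hxy.trans hy⟩ ⟨hy0.le, hy⟩ hx.ne' hy0.ne' hxy
  simp only [Real.sin_zero, neg_zero, sub_zero] at h
  rw [neg_div, neg_div] at h
  linarith

/-- The derivative of `a ↦ cos √a` at `a > 0`. [folklore] -/
private theorem hasDerivAt_cos_sqrt {a : ℝ} (ha : 0 < a) :
    HasDerivAt (fun b => Real.cos (Real.sqrt b)) (-Real.sin (Real.sqrt a) * (1 / (2 * Real.sqrt a))) a := by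
  have hs : HasDerivAt Real.sqrt (1 / (2 * Real.sqrt a)) a := Real.hasDerivAt_sqrt ha.ne'
  exact hs.cos

/-- **`a ↦ cos √a` is convex on `[0, π²]`.** [folklore] -/
private theorem convexOn_cos_sqrt : ConvexOn ℝ (Icc 0 (π ^ 2)) (fun a => Real.cos (Real.sqrt a)) := by
  have hint : interior (Icc (0 : ℝ) (π ^ 2)) = Ioo 0 (π ^ 2) := interior_Icc
  refine MonotoneOn.convexOn_of_deriv (convex_Icc _ _) ?_ ?_ ?_
  · exact (Real.continuous_cos.comp Real.continuous_sqrt).continuousOn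
  · rw [hint]
    intro a ha
    exact (hasDerivAt_cos_sqrt ha.1).differentiableAt.differentiableWithinAt
  · rw [hint]
    intro a ha b hb hab
    rw [(hasDerivAt_cos_sqrt ha.1).deriv, (hasDerivAt_cos_sqrt hb.1).deriv]
    have hsa : 0 < Real.sqrt a := Real.sqrt_pos.2 ha.1
    have hsb : 0 < Real.sqrt b := Real.sqrt_pos.2 hb.1
    have hab' : Real.sqrt a ≤ Real.sqrt b := Real.sqrt_le_sqrt hab
    have hbπ : Real.sqrt b ≤ π := by
      rw [← Real.sqrt_sq Real.pi_pos.le]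
      exact Real.sqrt_le_sqrt hb.2.le
    have h := sin_div_le_sin_div hsa hab' hbπ
    rw [div_le_div_iff₀ hsb hsa] at h
    have e1 : -Real.sin (Real.sqrt a) * (1 / (2 * Real.sqrt a)) = -(Real.sin (Real.sqrt a) / Real.sqrt a) / 2 := by
      field_simp
    have e2 : -Real.sin (Real.sqrt b) * (1 / (2 * Real.sqrt b)) = -(Real.sin (Real.sqrt b) / Real.sqrt b) / 2 := by
      field_simp
    rw [e1, e2]
    have h' : Real.sin (Real.sqrt b) / Real.sqrt b ≤ Real.sin (Real.sqrt a) / Real.sqrt a := by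
      rw [div_le_div_iff₀ hsb hsa]; linarith
    linarith

/-- Chord form of the convexity: `cos √u + cos √v ≤ 1 + cos √(u + v)` for `u, v ≥ 0`, `u + v ≤ π²`. [folklore] -/
private theorem cos_sqrt_add_cos_sqrt_le {u v : ℝ} (hu : 0 ≤ u) (hv : 0 ≤ v) (huv : u + v ≤ π ^ 2) :
    Real.cos (Real.sqrt u) + Real.cos (Real.sqrt v) ≤ 1 + Real.cos (Real.sqrt (u + v)) := by
  rcases (add_nonneg hu hv).eq_or_lt with h0 | hpos
  · have hu0 : u = 0 := by linarith
    have hv0 : v = 0 := by linarith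
    simp [hu0, hv0]
  have hc := convexOn_cos_sqrt
  have h0mem : (0 : ℝ) ∈ Icc 0 (π ^ 2) := ⟨le_rfl, by positivity⟩
  have hsmem : u + v ∈ Icc 0 (π ^ 2) := ⟨hpos.le, huv⟩
  -- `u = (v/(u+v))•0 + (u/(u+v))•(u+v)`, `v = (u/(u+v))•0 + (v/(u+v))•(u+v)`
  have hwu : 0 ≤ u / (u + v) := div_nonneg hu hpos.le
  have hwv : 0 ≤ v / (u + v) := div_nonneg hv hpos.le
  have hsum1 : v / (u + v) + u / (u + v) = 1 := by
    rw [← add_div, div_eq_one_iff_eq hpos.ne']; ring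
  have hsum2 : u / (u + v) + v / (u + v) = 1 := by
    rw [← add_div, div_eq_one_iff_eq hpos.ne']
  have h1 := hc.2 h0mem hsmem hwv hwu hsum1
  have h2 := hc.2 h0mem hsmem hwu hwv hsum2
  simp only [smul_eq_mul, mul_zero, zero_add, Real.sqrt_zero, Real.cos_zero, mul_one] at h1 h2
  have eu : u / (u + v) * (u + v) = u := by field_simp
  have ev : v / (u + v) * (u + v) = v := by field_simp
  rw [eu] at h1
  rw [ev] at h2
  have key : u / (u + v) * Real.cos (Real.sqrt (u + v)) + v / (u + v) * Real.cos (Real.sqrt (u + v)) =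
      Real.cos (Real.sqrt (u + v)) := by rw [← add_mul, hsum2, one_mul]
  linarith [h1, h2, key, hsum1]

/-- **`cos x + cos y ≤ 1 + cos √(x² + y²)`** whenever `x² + y² ≤ π²`: on a circle `|k⃗| = s ≤ π` the
function `cos k₁ + cos k₂` is largest on the axes. [folklore] -/
private theorem cos_add_cos_le_one_add_cos_norm {x y : ℝ} (h : x ^ 2 + y ^ 2 ≤ π ^ 2) :
    Real.cos x + Real.cos y ≤ 1 + Real.cos (Real.sqrt (x ^ 2 + y ^ 2)) := by
  have hx := cos_sqrt_add_cos_sqrt_le (sq_nonneg x) (sq_nonneg y) h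
  rwa [Real.sqrt_sq_eq_abs, Real.sqrt_sq_eq_abs, Real.cos_abs, Real.cos_abs] at hx

/-- **Euclidean radius of a sublevel set of the free band.** If `|kᵢ| ≤ π` and
`ε(k⃗) = -2(cos k₁ + cos k₂) ≤ L` with `L < -2`, then `|k⃗| = √(k₁² + k₂²) ≤ arccos(-L/2 - 1)` — the
axis radius `K(L)` of `HubbardUmklappKinematics` bounds the whole EUCLIDEAN radius (BGM 2006, Remark
after (2.39): "`|p⃗_F^{(0)}(θ)| ≤ arccos(1 - μ - e)`"). [cite: BenfattoGiulianiMastropietro2006, §2.4 Remark after (2.39) p0009:L25] -/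
theorem sqrt_sq_add_sq_le_umklappRadius {L : ℝ} (hL : L < -2) {k : Fin 2 → ℝ} (hk : ∀ i, |k i| ≤ π)
    (he : sqDispersion k ≤ L) : Real.sqrt (k 0 ^ 2 + k 1 ^ 2) ≤ umklappRadius L := by
  have hcos : -L / 2 ≤ Real.cos (k 0) + Real.cos (k 1) := by
    unfold sqDispersion at he; linarith
  -- each coordinate has `cos kᵢ > 0`, hence `|kᵢ| < π/2`
  have hci : ∀ i, 0 < Real.cos (k i) := by
    have h0 := Real.cos_le_one (k 0); have h1 := Real.cos_le_one (k 1)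
    intro i; fin_cases i
    · show 0 < Real.cos (k 0); linarith
    · show 0 < Real.cos (k 1); linarith
  have habs : ∀ i, |k i| < π / 2 := by
    intro i
    by_contra hge
    have hge : π / 2 ≤ |k i| := le_of_not_gt hge
    have : Real.cos (|k i|) ≤ 0 := Real.cos_nonpos_of_pi_div_two_le_of_le hge (by linarith [hk i])
    rw [Real.cos_abs] at this
    exact absurd (hci i) (not_lt.2 this)
  have hsq : k 0 ^ 2 + k 1 ^ 2 ≤ π ^ 2 := by
    have h0 := habs 0; have h1 := habs 1
    have h0' : k 0 ^ 2 < (π / 2) ^ 2 := by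
      rw [← sq_abs]; exact pow_lt_pow_left₀ h0 (abs_nonneg _) two_ne_zero
    have h1' : k 1 ^ 2 < (π / 2) ^ 2 := by
      rw [← sq_abs]; exact pow_lt_pow_left₀ h1 (abs_nonneg _) two_ne_zero
    nlinarith [Real.pi_pos]
  have hmain := cos_add_cos_le_one_add_cos_norm hsq
  have hs : Real.cos (Real.sqrt (k 0 ^ 2 + k 1 ^ 2)) ≥ -L / 2 - 1 := by linarith
  have hsπ : |Real.sqrt (k 0 ^ 2 + k 1 ^ 2)| ≤ π := by
    rw [abs_of_nonneg (Real.sqrt_nonneg _), ← Real.sqrt_sq Real.pi_pos.le]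
    exact Real.sqrt_le_sqrt hsq
  have := abs_le_arccos_of_le_cos hsπ hs.le
  rwa [abs_of_nonneg (Real.sqrt_nonneg _)] at this

/-- `K(L) < π/4` exactly when `L < -2 - √2` (`cos (π/4) = √2/2`). [cite: BenfattoGiulianiMastropietro2006, §2.4 Remark after (2.39) p0009:L25–L27] -/
theorem umklappRadius_lt_pi_div_four {L : ℝ} (hL₁ : -4 ≤ L) (hL : L < -2 - Real.sqrt 2) :
    umklappRadius L < π / 4 := by
  unfold umklappRadius
  rw [← Real.arccos_cos (x := π / 4) (by positivity) (by linarith [Real.pi_pos]), Real.cos_pi_div_four]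
  have h2 : 0 ≤ Real.sqrt 2 := Real.sqrt_nonneg 2
  exact Real.arccos_lt_arccos (by linarith) (by linarith) (by linarith)



/-! ### §A2 The polar frame and the free band along rays -/

/-- `e⃗_r' = e⃗_t`. [folklore] -/
private theorem hasDerivAt_dir_dirPerp (θ : ℝ) : HasDerivAt dir (dirPerp θ) θ := hasDerivAt_dir θ

/-- `e⃗_t' = -e⃗_r`. [folklore] -/
private theorem hasDerivAt_dirPerp (θ : ℝ) : HasDerivAt dirPerp (-dir θ) θ := by
  refine hasDerivAt_pi.2 fun i => ?_
  fin_cases i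
  · have h : HasDerivAt (fun x => -Real.sin x) (-Real.cos θ) θ := (Real.hasDerivAt_sin θ).neg
    simpa [dirPerp, dir] using h
  · simpa [dirPerp, dir] using Real.hasDerivAt_cos θ

/-- `e⃗_r` is smooth. [folklore] -/
private theorem contDiff_dir {n : WithTop ℕ∞} : ContDiff ℝ n dir := by
  refine contDiff_pi.2 fun i => ?_
  fin_cases i
  · simpa [dir] using Real.contDiff_cos
  · simpa [dir] using Real.contDiff_sin

/-- `e⃗_r(θ)₁ = cos θ`. [folklore] -/
@[simp] private theorem dir_apply_zero (θ : ℝ) : dir θ 0 = Real.cos θ := rfl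
/-- `e⃗_r(θ)₂ = sin θ`. [folklore] -/
@[simp] private theorem dir_apply_one (θ : ℝ) : dir θ 1 = Real.sin θ := rfl
/-- `e⃗_t(θ)₁ = -sin θ`. [folklore] -/
@[simp] private theorem dirPerp_apply_zero (θ : ℝ) : dirPerp θ 0 = -Real.sin θ := rfl
/-- `e⃗_t(θ)₂ = cos θ`. [folklore] -/
@[simp] private theorem dirPerp_apply_one (θ : ℝ) : dirPerp θ 1 = Real.cos θ := rfl

/-- `|cos θ| + |sin θ| ≤ 2`. [folklore] -/
private theorem abs_dir_add_le (θ : ℝ) : |dir θ 0| + |dir θ 1| ≤ 2 := by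
  have := Real.abs_cos_le_one θ; have := Real.abs_sin_le_one θ
  simp only [dir_apply_zero, dir_apply_one]; linarith

/-- `|sin θ| + |cos θ| ≤ 2`. [folklore] -/
private theorem abs_dirPerp_add_le (θ : ℝ) : |dirPerp θ 0| + |dirPerp θ 1| ≤ 2 := by
  have := Real.abs_cos_le_one θ; have := Real.abs_sin_le_one θ
  simp only [dirPerp_apply_zero, dirPerp_apply_one, abs_neg]; linarith

/-- `|a e⃗_r + b e⃗_t|² = a² + b²`. [folklore] -/
private theorem sq_add_sq_frame (a b θ : ℝ) :
    (a • dir θ + b • dirPerp θ) 0 ^ 2 + (a • dir θ + b • dirPerp θ) 1 ^ 2 = a ^ 2 + b ^ 2 := by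
  simp only [Pi.add_apply, Pi.smul_apply, smul_eq_mul, dir_apply_zero, dir_apply_one,
    dirPerp_apply_zero, dirPerp_apply_one]
  nlinarith [Real.sin_sq_add_cos_sq θ]

/-- Coordinates of a ray point: `|(t e⃗_r)ᵢ| ≤ t`. [folklore] -/
private theorem abs_smul_dir_apply_le' {t : ℝ} (ht : 0 ≤ t) (θ : ℝ) (i : Fin 2) : |(t • dir θ) i| ≤ t := by
  rw [Pi.smul_apply, smul_eq_mul, abs_mul, abs_of_nonneg ht]
  exact (mul_le_mul_of_nonneg_left (abs_dir_le_one θ i) ht).trans (by rw [mul_one])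

/-- The Euclidean radius of a ray point: `√((t e⃗_r)₁² + (t e⃗_r)₂²) = t`. [folklore] -/
private theorem sqrt_sq_smul_dir {t : ℝ} (ht : 0 ≤ t) (θ : ℝ) :
    Real.sqrt ((t • dir θ) 0 ^ 2 + (t • dir θ) 1 ^ 2) = t := by
  have h : (t • dir θ) 0 ^ 2 + (t • dir θ) 1 ^ 2 = t ^ 2 := by
    simp only [Pi.smul_apply, smul_eq_mul, dir_apply_zero, dir_apply_one]
    nlinarith [Real.sin_sq_add_cos_sq θ]
  rw [h, Real.sqrt_sq ht]

/-- **The radial derivative of the free band**: `∇ε₀(t e⃗_r)·e⃗_r = 2(cos θ sin(t cos θ) + sin θ sin(t sin θ))`. [folklore] -/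
private theorem fderiv_sqDispersion_ray_dir (t θ : ℝ) :
    fderiv ℝ sqDispersion (t • dir θ) (dir θ) =
      2 * (Real.cos θ * Real.sin (t * Real.cos θ) + Real.sin θ * Real.sin (t * Real.sin θ)) := by
  rw [fderiv_sqDispersion_apply]
  simp only [Pi.smul_apply, smul_eq_mul, dir_apply_zero, dir_apply_one]
  ring

/-- `c · sin(t c) ≥ (2/π) t c²` for `0 ≤ t`, `t|c| ≤ π/2` (`sin x ≥ 2x/π` on `[0, π/2]`, oddness). [folklore] -/
private theorem mul_sin_mul_ge {t c : ℝ} (ht : 0 ≤ t) (hc : |c| ≤ 1) (htπ : t ≤ π / 2) :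
    2 / π * t * c ^ 2 ≤ c * Real.sin (t * c) := by
  have key : ∀ a : ℝ, 0 ≤ a → a ≤ 1 → 2 / π * t * a ^ 2 ≤ a * Real.sin (t * a) := by
    intro a ha0 ha1
    have hta : t * a ≤ π / 2 := by nlinarith [Real.pi_pos]
    have h := Real.mul_le_sin (by positivity : 0 ≤ t * a) hta
    calc 2 / π * t * a ^ 2 = a * (2 / π * (t * a)) := by ring
      _ ≤ a * Real.sin (t * a) := mul_le_mul_of_nonneg_left h ha0
  rcases le_total 0 c with h0 | h0
  · exact key c h0 ((le_abs_self c).trans hc)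
  · have h := key (-c) (by linarith) ((neg_le_abs c).trans hc)
    have e1 : (-c) ^ 2 = c ^ 2 := by ring
    have e2 : -c * Real.sin (t * -c) = c * Real.sin (t * c) := by
      rw [mul_neg, Real.sin_neg]; ring
    rwa [e1, e2] at h

/-- `c · sin(t c) ≤ t c²` for `0 ≤ t` (`sin x ≤ x` for `x ≥ 0`, oddness). [folklore] -/
private theorem mul_sin_mul_le {t c : ℝ} (ht : 0 ≤ t) : c * Real.sin (t * c) ≤ t * c ^ 2 := by
  have key : ∀ a : ℝ, 0 ≤ a → a * Real.sin (t * a) ≤ t * a ^ 2 := by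
    intro a ha0
    have h := Real.sin_le (by positivity : 0 ≤ t * a)
    calc a * Real.sin (t * a) ≤ a * (t * a) := mul_le_mul_of_nonneg_left h ha0
      _ = t * a ^ 2 := by ring
  rcases le_total 0 c with h0 | h0
  · exact key c h0
  · have h := key (-c) (by linarith)
    have e1 : (-c) ^ 2 = c ^ 2 := by ring
    have e2 : -c * Real.sin (t * -c) = c * Real.sin (t * c) := by
      rw [mul_neg, Real.sin_neg]; ring
    rwa [e1, e2] at h

/-- **`4t/π ≤ ∇ε₀(t e⃗_r)·e⃗_r ≤ 2t`** for `0 ≤ t ≤ π/2`. [folklore] -/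
private theorem fderiv_sqDispersion_ray_dir_bounds {t : ℝ} (ht : 0 ≤ t) (htπ : t ≤ π / 2) (θ : ℝ) :
    4 / π * t ≤ fderiv ℝ sqDispersion (t • dir θ) (dir θ) ∧
      fderiv ℝ sqDispersion (t • dir θ) (dir θ) ≤ 2 * t := by
  rw [fderiv_sqDispersion_ray_dir]
  have h1 := mul_sin_mul_ge ht (Real.abs_cos_le_one θ) htπ
  have h2 := mul_sin_mul_ge ht (Real.abs_sin_le_one θ) htπ
  have h3 := mul_sin_mul_le (c := Real.cos θ) ht
  have h4 := mul_sin_mul_le (c := Real.sin θ) ht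
  have hcs : Real.cos θ ^ 2 + Real.sin θ ^ 2 = 1 := by rw [add_comm]; exact Real.sin_sq_add_cos_sq θ
  constructor
  · have : 2 / π * t * Real.cos θ ^ 2 + 2 / π * t * Real.sin θ ^ 2 = 2 / π * t := by
      rw [← mul_add, hcs, mul_one]
    have h12 := add_le_add h1 h2
    rw [this] at h12
    have e : 4 / π * t = 2 * (2 / π * t) := by ring
    rw [e]
    linarith
  · have h34 := add_le_add h3 h4
    have : t * Real.cos θ ^ 2 + t * Real.sin θ ^ 2 = t := by rw [← mul_add, hcs, mul_one]
    rw [this] at h34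
    linarith

/-- **The tangential derivative of the free band**: `|∇ε₀(t e⃗_r)·e⃗_t| ≤ 2t` for `t ≥ 0`. [folklore] -/
private theorem abs_fderiv_sqDispersion_ray_dirPerp_le {t : ℝ} (ht : 0 ≤ t) (θ : ℝ) :
    |fderiv ℝ sqDispersion (t • dir θ) (dirPerp θ)| ≤ 2 * t := by
  rw [fderiv_sqDispersion_apply]
  simp only [Pi.smul_apply, smul_eq_mul, dir_apply_zero, dir_apply_one, dirPerp_apply_zero,
    dirPerp_apply_one]
  have h1 : |Real.sin (t * Real.cos θ)| ≤ t * |Real.cos θ| := by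
    calc |Real.sin (t * Real.cos θ)| ≤ |t * Real.cos θ| := Real.abs_sin_le_abs
      _ = t * |Real.cos θ| := by rw [abs_mul, abs_of_nonneg ht]
  have h2 : |Real.sin (t * Real.sin θ)| ≤ t * |Real.sin θ| := by
    calc |Real.sin (t * Real.sin θ)| ≤ |t * Real.sin θ| := Real.abs_sin_le_abs
      _ = t * |Real.sin θ| := by rw [abs_mul, abs_of_nonneg ht]
  have hc := Real.abs_cos_le_one θ; have hs := Real.abs_sin_le_one θ
  have hprod : |Real.sin θ| * |Real.cos θ| ≤ 1 / 2 := by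
    rw [← abs_mul]
    have : Real.sin θ * Real.cos θ = Real.sin (2 * θ) / 2 := by rw [Real.sin_two_mul]; ring
    rw [this, abs_div, abs_two]
    linarith [Real.abs_sin_le_one (2 * θ)]
  calc |2 * Real.sin (t * Real.cos θ) * -Real.sin θ + 2 * Real.sin (t * Real.sin θ) * Real.cos θ|
      ≤ |2 * Real.sin (t * Real.cos θ) * -Real.sin θ| + |2 * Real.sin (t * Real.sin θ) * Real.cos θ| :=
        abs_add_le _ _
    _ = 2 * (|Real.sin (t * Real.cos θ)| * |Real.sin θ|) + 2 * (|Real.sin (t * Real.sin θ)| * |Real.cos θ|) := by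
        simp only [abs_mul, abs_neg, abs_two]; ring
    _ ≤ 2 * (t * |Real.cos θ| * |Real.sin θ|) + 2 * (t * |Real.sin θ| * |Real.cos θ|) := by
        gcongr
    _ = 4 * t * (|Real.sin θ| * |Real.cos θ|) := by ring
    _ ≤ 4 * t * (1 / 2) := by gcongr
    _ = 2 * t := by ring

/-- The free band below a ray point: `ε₀(t e⃗_r) ≤ -4 + t²` (`cos x ≥ 1 - x²/2`). [folklore] -/
private theorem sqDispersion_ray_le (t θ : ℝ) : sqDispersion (t • dir θ) ≤ -4 + t ^ 2 := by
  have h1 := Real.one_sub_sq_div_two_le_cos (x := t * Real.cos θ)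
  have h2 := Real.one_sub_sq_div_two_le_cos (x := t * Real.sin θ)
  have hcs := Real.sin_sq_add_cos_sq θ
  simp only [sqDispersion, Pi.smul_apply, smul_eq_mul, dir_apply_zero, dir_apply_one]
  nlinarith

/-! ### §A2b The Hessian of the free band -/

/-- The gradient of `ε₀` as a map into the dual: `Dε₀(k) = 2 sin k₁ · pr₁ + 2 sin k₂ · pr₂`. [folklore] -/
private theorem fderiv_sqDispersion_eq :
    fderiv ℝ sqDispersion = fun k : Fin 2 → ℝ =>
      (2 * Real.sin (k 0)) • ContinuousLinearMap.proj (R := ℝ) (φ := fun _ : Fin 2 => ℝ) 0 +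
        (2 * Real.sin (k 1)) • ContinuousLinearMap.proj (R := ℝ) (φ := fun _ : Fin 2 => ℝ) 1 := by
  funext k
  ext v
  rw [fderiv_sqDispersion_apply]
  simp

/-- **`D²ε₀(k)(v, w) = 2 (cos k₁ v₁ w₁ + cos k₂ v₂ w₂)`** (`Hess ε₀ = 2 diag(cos k₁, cos k₂)`). [cite: BenfattoGiulianiMastropietro2006, §2.4 (2.37) and proof of Lemma 2.1 p0009:L95–L99] -/
theorem fderiv_fderiv_sqDispersion_apply (k v w : Fin 2 → ℝ) :
    fderiv ℝ (fderiv ℝ sqDispersion) k v w =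
      2 * (Real.cos (k 0) * v 0 * w 0 + Real.cos (k 1) * v 1 * w 1) := by
  set P0 : (Fin 2 → ℝ) →L[ℝ] ℝ := ContinuousLinearMap.proj (R := ℝ) (φ := fun _ : Fin 2 => ℝ) 0
  set P1 : (Fin 2 → ℝ) →L[ℝ] ℝ := ContinuousLinearMap.proj (R := ℝ) (φ := fun _ : Fin 2 => ℝ) 1
  have hc0 : HasFDerivAt (fun q : Fin 2 → ℝ => 2 * Real.sin (q 0)) ((2 * Real.cos (k 0)) • P0) k := by
    have h := ((Real.hasDerivAt_sin (k 0)).comp_hasFDerivAt k P0.hasFDerivAt).const_mul 2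
    have e : (2 : ℝ) • Real.cos (P0 k) • P0 = (2 * Real.cos (k 0)) • P0 := by
      rw [smul_smul]; rfl
    rw [← e]
    exact h
  have hc1 : HasFDerivAt (fun q : Fin 2 → ℝ => 2 * Real.sin (q 1)) ((2 * Real.cos (k 1)) • P1) k := by
    have h := ((Real.hasDerivAt_sin (k 1)).comp_hasFDerivAt k P1.hasFDerivAt).const_mul 2
    have e : (2 : ℝ) • Real.cos (P1 k) • P1 = (2 * Real.cos (k 1)) • P1 := by
      rw [smul_smul]; rfl
    rw [← e]
    exact h
  have h : HasFDerivAt (fderiv ℝ sqDispersion)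
      (((2 * Real.cos (k 0)) • P0).smulRight P0 + ((2 * Real.cos (k 1)) • P1).smulRight P1) k := by
    rw [fderiv_sqDispersion_eq]
    exact (hc0.smul_const P0).add (hc1.smul_const P1)
  rw [h.fderiv]
  simp [P0, P1]
  ring


/-! ### §A3 Roots of the ray equation `ε(t e⃗_r(θ)) = lev` for a perturbed band -/

section Perturbed

variable {ε : (Fin 2 → ℝ) → ℝ} {δ₀ δ₁ c : ℝ}

/-- The derivative of `ε` along a ray. [folklore] -/
private theorem hasDerivAt_eps_ray (hε : Differentiable ℝ ε) (θ t : ℝ) :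
    HasDerivAt (fun s : ℝ => ε (s • dir θ)) (fderiv ℝ ε (t • dir θ) (dir θ)) t := by
  have hl : HasDerivAt (fun s : ℝ => s • dir θ) (dir θ) t := by
    simpa using (hasDerivAt_id t).smul_const (dir θ)
  exact (hε (t • dir θ)).hasFDerivAt.comp_hasDerivAt t hl

/-- Continuity of `ε` along a ray. [folklore] -/
private theorem continuous_eps_ray (hε : Continuous ε) (θ : ℝ) : Continuous (fun s : ℝ => ε (s • dir θ)) :=
  hε.comp (continuous_id.smul continuous_const)

/-- A gradient `δ₁`-close to `∇ε₀` has radial component `≥ 4t/π - 2δ₁` on `0 ≤ t ≤ π/2`. [folklore] -/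
private theorem fderiv_ray_dir_ge
    (h1 : ∀ k v, |fderiv ℝ ε k v - fderiv ℝ sqDispersion k v| ≤ δ₁ * (|v 0| + |v 1|)) (hδ₁ : 0 ≤ δ₁)
    {t : ℝ} (ht : 0 ≤ t) (htπ : t ≤ π / 2) (θ : ℝ) :
    4 / π * t - 2 * δ₁ ≤ fderiv ℝ ε (t • dir θ) (dir θ) := by
  have h := h1 (t • dir θ) (dir θ)
  have hb := (fderiv_sqDispersion_ray_dir_bounds ht htπ θ).1
  have h2 : δ₁ * (|dir θ 0| + |dir θ 1|) ≤ δ₁ * 2 := mul_le_mul_of_nonneg_left (abs_dir_add_le θ) hδ₁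
  have h3 := (abs_le.1 (h.trans h2)).1
  linarith

/-- … and `≤ 2t + 2δ₁`. [folklore] -/
private theorem fderiv_ray_dir_le
    (h1 : ∀ k v, |fderiv ℝ ε k v - fderiv ℝ sqDispersion k v| ≤ δ₁ * (|v 0| + |v 1|)) (hδ₁ : 0 ≤ δ₁)
    {t : ℝ} (ht : 0 ≤ t) (htπ : t ≤ π / 2) (θ : ℝ) :
    fderiv ℝ ε (t • dir θ) (dir θ) ≤ 2 * t + 2 * δ₁ := by
  have h := h1 (t • dir θ) (dir θ)
  have hb := (fderiv_sqDispersion_ray_dir_bounds ht htπ θ).2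
  have h2 : δ₁ * (|dir θ 0| + |dir θ 1|) ≤ δ₁ * 2 := mul_le_mul_of_nonneg_left (abs_dir_add_le θ) hδ₁
  have h3 := (abs_le.1 (h.trans h2)).2
  linarith

/-- … and tangential component `|∇ε(t e⃗_r)·e⃗_t| ≤ 2t + 2δ₁`. [folklore] -/
private theorem abs_fderiv_ray_dirPerp_le
    (h1 : ∀ k v, |fderiv ℝ ε k v - fderiv ℝ sqDispersion k v| ≤ δ₁ * (|v 0| + |v 1|)) (hδ₁ : 0 ≤ δ₁)
    {t : ℝ} (ht : 0 ≤ t) (θ : ℝ) :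
    |fderiv ℝ ε (t • dir θ) (dirPerp θ)| ≤ 2 * t + 2 * δ₁ := by
  have h := h1 (t • dir θ) (dirPerp θ)
  have hb := abs_fderiv_sqDispersion_ray_dirPerp_le ht θ
  have h2 : δ₁ * (|dirPerp θ 0| + |dirPerp θ 1|) ≤ δ₁ * 2 :=
    mul_le_mul_of_nonneg_left (abs_dirPerp_add_le θ) hδ₁
  have h3 := abs_le.1 (h.trans h2)
  have h4 := abs_le.1 hb
  rw [abs_le]; constructor <;> linarith

/-- `2δ₁ < 4c/π` forces `c > 0`. [folklore] -/
private theorem pos_of_gap (hδ₁ : 0 ≤ δ₁) (hc : 2 * δ₁ < 4 / π * c) : 0 < c := by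
  by_contra h
  have : 4 / π * c ≤ 0 := mul_nonpos_of_nonneg_of_nonpos (by positivity) (le_of_not_gt h)
  linarith

/-- **Radial strict monotonicity** on `[c, π/2]` as soon as `2δ₁ < 4c/π`. [folklore] -/
private theorem strictMonoOn_ray (hε : ContDiff ℝ 2 ε)
    (h1 : ∀ k v, |fderiv ℝ ε k v - fderiv ℝ sqDispersion k v| ≤ δ₁ * (|v 0| + |v 1|)) (hδ₁ : 0 ≤ δ₁)
    (hc : 2 * δ₁ < 4 / π * c) (θ : ℝ) :
    StrictMonoOn (fun s : ℝ => ε (s • dir θ)) (Icc c (π / 2)) := by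
  have hc0 : 0 ≤ c := (pos_of_gap hδ₁ hc).le
  refine strictMonoOn_of_deriv_pos (convex_Icc _ _) (continuous_eps_ray hε.continuous θ).continuousOn ?_
  intro s hs
  rw [interior_Icc] at hs
  rw [(hasDerivAt_eps_ray (hε.differentiable (by simp)) θ s).deriv]
  have h := fderiv_ray_dir_ge h1 hδ₁ (hc0.trans hs.1.le) hs.2.le θ
  have : 4 / π * c ≤ 4 / π * s := mul_le_mul_of_nonneg_left hs.1.le (by positivity)
  linarith

/-- A root of `ε(t e⃗_r) = lev` has `t² ≥ lev + 4 - δ₀` (`ε₀(t e⃗_r) ≤ -4 + t²`). [folklore] -/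
private theorem le_sq_of_root (h0 : ∀ k, |ε k - sqDispersion k| ≤ δ₀) {θ t lev : ℝ}
    (hroot : ε (t • dir θ) = lev) : lev + 4 - δ₀ ≤ t ^ 2 := by
  have h := (abs_le.1 (h0 (t • dir θ))).2
  have hb := sqDispersion_ray_le t θ
  linarith

/-- … hence `t ≥ c` once `c² ≤ lev + 4 - δ₀`, `c, t ≥ 0`. [folklore] -/
private theorem le_of_root (h0 : ∀ k, |ε k - sqDispersion k| ≤ δ₀) {θ t lev : ℝ}
    (hclev : c ^ 2 ≤ lev + 4 - δ₀) (ht : 0 ≤ t) (hroot : ε (t • dir θ) = lev) : c ≤ t := by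
  have h := le_sq_of_root h0 hroot
  by_contra hlt
  have hlt : t < c := lt_of_not_ge hlt
  have : t ^ 2 < c ^ 2 := by nlinarith
  linarith

/-- **A point of the level set `{ε = lev}` in `[-π, π]²` has Euclidean radius `≤ K(lev + δ₀)`.** [folklore] -/
private theorem sqrt_sq_add_sq_le_of_level (h0 : ∀ k, |ε k - sqDispersion k| ≤ δ₀) {lev : ℝ}
    (hL : lev + δ₀ < -2) {k : Fin 2 → ℝ} (hk : ∀ i, |k i| ≤ π) (hroot : ε k = lev) :
    Real.sqrt (k 0 ^ 2 + k 1 ^ 2) ≤ umklappRadius (lev + δ₀) := by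
  have h := (abs_le.1 (h0 k)).1
  exact sqrt_sq_add_sq_le_umklappRadius hL hk (by linarith)

/-- Points of `[-π, π]²` have `|kᵢ| ≤ π`. [folklore] -/
private theorem abs_le_pi_of_mem_zoneSq {k : Fin 2 → ℝ} (hk : k ∈ zoneSq) (i : Fin 2) : |k i| ≤ π := by
  have h := hk i (Set.mem_univ i)
  exact abs_le.2 ⟨h.1, h.2⟩

/-- Ray points with `0 ≤ t ≤ π/2` lie in `[-π, π]²`. [folklore] -/
private theorem smul_dir_mem_zoneSq {t : ℝ} (ht : 0 ≤ t) (htπ : t ≤ π / 2) (θ : ℝ) : t • dir θ ∈ zoneSq := by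
  intro i _
  have h := abs_smul_dir_apply_le' ht θ i
  have h' := abs_le.1 h
  exact ⟨by linarith [Real.pi_pos], by linarith [Real.pi_pos]⟩

/-- **Existence of a root** in `(0, π/2)` for levels `-4 + δ₀ < lev < -2 - √2 - δ₀`
(intermediate values between `ε(0) ≤ -4 + δ₀` and the exit radius of `HubbardFermiRadius`). [cite: BenfattoGiulianiMastropietro2006, §2.4 Lemma 2.1 (1) p0009:L44–L50] -/
theorem exists_isLevelRadius (hε : Continuous ε) (h0 : ∀ k, |ε k - sqDispersion k| ≤ δ₀) {lev : ℝ}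
    (hlo : -4 + δ₀ < lev) (hhi : lev + δ₀ < -2 - Real.sqrt 2) (θ : ℝ) :
    ∃ t, IsLevelRadius ε lev θ t := by
  obtain ⟨T, hT0, hTπ, hTμ⟩ := exists_exit θ hhi
  have hcont : ContinuousOn (fun s : ℝ => ε (s • dir θ)) (Icc 0 T) := (continuous_eps_ray hε θ).continuousOn
  have hf0 : ε ((0 : ℝ) • dir θ) < lev := by
    have h := (abs_le.1 (h0 ((0 : ℝ) • dir θ))).2
    rw [zero_smul, sqDispersion_zero] at h
    rw [zero_smul]; linarith
  have hfT : lev < ε (T • dir θ) := by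
    have h := (abs_le.1 (h0 (T • dir θ))).1
    linarith
  obtain ⟨t, ht, hte⟩ : ∃ t ∈ Ioo 0 T, ε (t • dir θ) = lev :=
    intermediate_value_Ioo hT0.le hcont ⟨hf0, hfT⟩
  exact ⟨t, ⟨ht.1.le, ht.2.le.trans hTπ⟩, hte⟩

/-- **Uniqueness of the root** in `[0, π/2]` (both roots are `≥ c`, and `ε` increases strictly along
the ray on `[c, π/2]`). [cite: BenfattoGiulianiMastropietro2006, §2.4 Lemma 2.1 (1) p0009:L44–L50] -/
theorem isLevelRadius_unique (hε : ContDiff ℝ 2 ε) (h0 : ∀ k, |ε k - sqDispersion k| ≤ δ₀)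
    (h1 : ∀ k v, |fderiv ℝ ε k v - fderiv ℝ sqDispersion k v| ≤ δ₁ * (|v 0| + |v 1|)) (hδ₁ : 0 ≤ δ₁)
    (hc : 2 * δ₁ < 4 / π * c) {lev θ s t : ℝ} (hclev : c ^ 2 ≤ lev + 4 - δ₀)
    (hs : IsLevelRadius ε lev θ s) (ht : IsLevelRadius ε lev θ t) : s = t := by
  have hsc : c ≤ s := le_of_root h0 hclev hs.1.1 hs.2
  have htc : c ≤ t := le_of_root h0 hclev ht.1.1 ht.2
  exact (strictMonoOn_ray hε h1 hδ₁ hc θ).injOn ⟨hsc, hs.1.2⟩ ⟨htc, ht.1.2⟩ (hs.2.trans ht.2.symm)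

/-- The polar radius `levelRadius ε lev θ` IS a root once one exists (Hilbert `ε`). [folklore] -/
private theorem isLevelRadius_levelRadius {lev θ : ℝ} (h : ∃ t, IsLevelRadius ε lev θ t) :
    IsLevelRadius ε lev θ (levelRadius ε lev θ) :=
  Classical.epsilon_spec h

end Perturbed


/-! ### §A4 Smoothness of the polar radius: the implicit function theorem -/

section Implicit

variable {ε : (Fin 2 → ℝ) → ℝ} {δ₀ δ₁ c : ℝ} {n : WithTop ℕ∞}

/-- The implicit equation of the polar chart, `f((lev, θ), t) = ε(t e⃗_r(θ)) - lev`, is as smooth as `ε`. [folklore] -/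
private theorem contDiff_levelEquation (hε : ContDiff ℝ n ε) :
    ContDiff ℝ n (fun x : (ℝ × ℝ) × ℝ => ε (x.2 • dir x.1.2) - x.1.1) :=
  (hε.comp (contDiff_snd.smul (contDiff_dir.comp (contDiff_snd.comp contDiff_fst)))).sub
    (contDiff_fst.comp contDiff_fst)

/-- The `t`-partial of the implicit equation is multiplication by the radial derivative
`∇ε(t e⃗_r)·e⃗_r`. [folklore] -/
private theorem fderiv_levelEquation_comp_inr_apply (hε : ContDiff ℝ n ε) (hn : n ≠ 0) (lev θ t s : ℝ) :
    (fderiv ℝ (fun x : (ℝ × ℝ) × ℝ => ε (x.2 • dir x.1.2) - x.1.1) ((lev, θ), t) ∘L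
      ContinuousLinearMap.inr ℝ (ℝ × ℝ) ℝ) s = s * fderiv ℝ ε (t • dir θ) (dir θ) := by
  set f : (ℝ × ℝ) × ℝ → ℝ := fun x => ε (x.2 • dir x.1.2) - x.1.1 with hf
  set L := fderiv ℝ f ((lev, θ), t) ∘L ContinuousLinearMap.inr ℝ (ℝ × ℝ) ℝ with hL
  have hdf : DifferentiableAt ℝ f ((lev, θ), t) :=
    ((contDiff_levelEquation hε).differentiable hn) _
  have hcomp : HasFDerivAt (fun τ : ℝ => f ((lev, θ), τ)) L t :=
    hdf.hasFDerivAt.comp t (hasFDerivAt_prodMk_right ((lev, θ) : ℝ × ℝ) t)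
  have hray : HasDerivAt (fun τ : ℝ => f ((lev, θ), τ)) (fderiv ℝ ε (t • dir θ) (dir θ)) t := by
    have h := (hasDerivAt_eps_ray (hε.differentiable hn) θ t).sub_const lev
    exact h
  have h1 : L 1 = fderiv ℝ ε (t • dir θ) (dir θ) := by
    have := hcomp.hasDerivAt.unique hray
    exact this
  have hs : L s = s * L 1 := by
    have := L.map_smul s (1 : ℝ)
    simpa using this
  rw [hs, h1]

/-- Where the radial derivative is nonzero, the `t`-partial of the implicit equation is invertible. [folklore] -/
private theorem isInvertible_fderiv_levelEquation_comp_inr (hε : ContDiff ℝ n ε) (hn : n ≠ 0) {lev θ t : ℝ}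
    (h : fderiv ℝ ε (t • dir θ) (dir θ) ≠ 0) :
    (fderiv ℝ (fun x : (ℝ × ℝ) × ℝ => ε (x.2 • dir x.1.2) - x.1.1) ((lev, θ), t) ∘L
      ContinuousLinearMap.inr ℝ (ℝ × ℝ) ℝ).IsInvertible := by
  refine ⟨ContinuousLinearEquiv.unitsEquivAut ℝ (Units.mk0 _ h), ContinuousLinearMap.ext_ring ?_⟩
  rw [ContinuousLinearEquiv.coe_coe, ContinuousLinearEquiv.unitsEquivAut_apply, Units.val_mk0,
    fderiv_levelEquation_comp_inr_apply hε hn]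

/-- **Bounds on the polar radius** at an admissible level: `c ≤ u ≤ K(lev + δ₀) < π/4`. [cite: BenfattoGiulianiMastropietro2006, §2.4 Lemma 2.1 (1) p0009:L44–L50] -/
theorem levelRadius_bounds (hε : ContDiff ℝ 2 ε) (h0 : ∀ k, |ε k - sqDispersion k| ≤ δ₀)
    (hδ₁ : 0 ≤ δ₁) (hc : 2 * δ₁ < 4 / π * c) {lev : ℝ} (hlev : lev ∈ Ioo (c ^ 2 + δ₀ - 4) (-2 - Real.sqrt 2 - δ₀))
    (θ : ℝ) :
    IsLevelRadius ε lev θ (levelRadius ε lev θ) ∧ c ≤ levelRadius ε lev θ ∧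
      levelRadius ε lev θ ≤ umklappRadius (lev + δ₀) ∧ umklappRadius (lev + δ₀) < π / 4 := by
  have hc0 := pos_of_gap hδ₁ hc
  have hex := exists_isLevelRadius hε.continuous h0 (lev := lev) (by nlinarith [hlev.1]) (by linarith [hlev.2]) θ
  have hu := isLevelRadius_levelRadius hex
  refine ⟨hu, le_of_root h0 (by linarith [hlev.1]) hu.1.1 hu.2, ?_, ?_⟩
  · have h := sqrt_sq_add_sq_le_of_level h0 (lev := lev)
      (by linarith [hlev.2, Real.sqrt_nonneg 2]) (fun i => abs_le_pi_of_mem_zoneSq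
        (smul_dir_mem_zoneSq hu.1.1 hu.1.2 θ) i) hu.2
    rwa [sqrt_sq_smul_dir hu.1.1] at h
  · have hδ₀ : 0 ≤ δ₀ := (abs_nonneg _).trans (h0 0)
    exact umklappRadius_lt_pi_div_four (by nlinarith [hlev.1, sq_nonneg c]) (by linarith [hlev.2])

/-- Any root in `[0, π/2]` at an admissible level is THE polar radius. [cite: BenfattoGiulianiMastropietro2006, §2.4 Lemma 2.1 (1) p0009:L44–L50] -/
theorem eq_levelRadius_of_isLevelRadius (hε : ContDiff ℝ 2 ε) (h0 : ∀ k, |ε k - sqDispersion k| ≤ δ₀)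
    (h1 : ∀ k v, |fderiv ℝ ε k v - fderiv ℝ sqDispersion k v| ≤ δ₁ * (|v 0| + |v 1|)) (hδ₁ : 0 ≤ δ₁)
    (hc : 2 * δ₁ < 4 / π * c) {lev : ℝ} (hlev : lev ∈ Ioo (c ^ 2 + δ₀ - 4) (-2 - Real.sqrt 2 - δ₀))
    {θ t : ℝ} (ht : IsLevelRadius ε lev θ t) : t = levelRadius ε lev θ :=
  isLevelRadius_unique hε h0 h1 hδ₁ hc (by linarith [hlev.1]) ht
    (levelRadius_bounds hε h0 hδ₁ hc hlev θ).1

/-- **The polar radius is jointly `Cⁿ` in (level, angle)** on the admissible levels: the implicit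
function theorem (`ContDiffAt.implicitFunction`) for `ε(t e⃗_r(θ)) - lev = 0` at the root, whose
`t`-partial `∇ε·e⃗_r ≥ 4c/π - 2δ₁ > 0`, plus uniqueness of the root in `[0, π/2]` — BGM: "the equation
`ε_h(k⃗) - μ = e` can be inverted … as it follows from an application of implicit function Theorem".
[cite: BenfattoGiulianiMastropietro2006, §2.4 proof of Lemma 2.1 p0009:L85–L90] -/
theorem contDiffAt_levelRadius_uncurry (hε : ContDiff ℝ n ε) (hn : 2 ≤ n)
    (h0 : ∀ k, |ε k - sqDispersion k| ≤ δ₀)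
    (h1 : ∀ k v, |fderiv ℝ ε k v - fderiv ℝ sqDispersion k v| ≤ δ₁ * (|v 0| + |v 1|)) (hδ₁ : 0 ≤ δ₁)
    (hc : 2 * δ₁ < 4 / π * c) {lev θ : ℝ} (hlev : lev ∈ Ioo (c ^ 2 + δ₀ - 4) (-2 - Real.sqrt 2 - δ₀)) :
    ContDiffAt ℝ n (fun p : ℝ × ℝ => levelRadius ε p.1 p.2) (lev, θ) := by
  have hε2 : ContDiff ℝ 2 ε := hε.of_le hn
  have hn0 : n ≠ 0 := by
    intro h; rw [h] at hn; exact absurd hn (by norm_num)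
  have hc0 := pos_of_gap hδ₁ hc
  obtain ⟨hu, hcu, huK, hK⟩ := levelRadius_bounds hε2 h0 hδ₁ hc hlev θ
  set t₀ := levelRadius ε lev θ with ht₀
  set f : (ℝ × ℝ) × ℝ → ℝ := fun x => ε (x.2 • dir x.1.2) - x.1.1 with hf
  -- the radial derivative at the root is positive
  have ha : 0 < fderiv ℝ ε (t₀ • dir θ) (dir θ) := by
    have h := fderiv_ray_dir_ge h1 hδ₁ hu.1.1 hu.1.2 θ
    have : 4 / π * c ≤ 4 / π * t₀ := mul_le_mul_of_nonneg_left hcu (by positivity)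
    linarith
  have cdf : ContDiffAt ℝ n f ((lev, θ), t₀) := (contDiff_levelEquation hε).contDiffAt
  have if₂ := isInvertible_fderiv_levelEquation_comp_inr hε hn0 (lev := lev) ha.ne'
  have hψ : ContDiffAt ℝ n (cdf.implicitFunction hn0 if₂) (lev, θ) := cdf.contDiffAt_implicitFunction hn0 if₂
  have hψ0 : cdf.implicitFunction hn0 if₂ (lev, θ) = t₀ := cdf.implicitFunction_apply_self hn0 if₂
  have hev1 : ∀ᶠ x in 𝓝 ((lev, θ) : ℝ × ℝ), f (x, cdf.implicitFunction hn0 if₂ x) = f ((lev, θ), t₀) :=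
    cdf.eventually_apply_implicitFunction hn0 if₂
  have hbase : f ((lev, θ), t₀) = 0 := by
    simp only [hf]
    rw [hu.2]; ring
  -- the implicit function stays in `(0, π/2)`, the level stays admissible
  have hopen : IsOpen (Ioo (0 : ℝ) (π / 2)) := isOpen_Ioo
  have ht₀mem : t₀ ∈ Ioo (0 : ℝ) (π / 2) := ⟨hc0.trans_le hcu, by linarith [huK, hK, Real.pi_pos]⟩
  have hev2 : ∀ᶠ x in 𝓝 ((lev, θ) : ℝ × ℝ), cdf.implicitFunction hn0 if₂ x ∈ Ioo (0 : ℝ) (π / 2) := by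
    have hcont : ContinuousAt (cdf.implicitFunction hn0 if₂) (lev, θ) := hψ.continuousAt
    have : Ioo (0 : ℝ) (π / 2) ∈ 𝓝 (cdf.implicitFunction hn0 if₂ (lev, θ)) := by
      rw [hψ0]; exact hopen.mem_nhds ht₀mem
    exact hcont.preimage_mem_nhds this
  have hev3 : ∀ᶠ x : ℝ × ℝ in 𝓝 ((lev, θ) : ℝ × ℝ), x.1 ∈ Ioo (c ^ 2 + δ₀ - 4) (-2 - Real.sqrt 2 - δ₀) :=
    continuous_fst.continuousAt.eventually (isOpen_Ioo.mem_nhds hlev)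
  have heq : (fun p : ℝ × ℝ => levelRadius ε p.1 p.2) =ᶠ[𝓝 ((lev, θ) : ℝ × ℝ)]
      cdf.implicitFunction hn0 if₂ := by
    filter_upwards [hev1, hev2, hev3] with x hx1 hx2 hx3
    have hroot : IsLevelRadius ε x.1 x.2 (cdf.implicitFunction hn0 if₂ x) := by
      refine ⟨⟨hx2.1.le, hx2.2.le⟩, ?_⟩
      rw [hbase] at hx1
      simp only [hf] at hx1
      linarith
    exact (eq_levelRadius_of_isLevelRadius hε2 h0 h1 hδ₁ hc hx3 hroot).symm
  exact hψ.congr_of_eventuallyEq heq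

/-- **`θ ↦ u(θ, e)` is `Cⁿ`** at every admissible level (Lemma 2.1 (1): "`u ∈ C²`", indeed as smooth
as `ε_h`). [cite: BenfattoGiulianiMastropietro2006, §2.4 Lemma 2.1 (1) p0009:L44] -/
theorem contDiff_levelRadius (hε : ContDiff ℝ n ε) (hn : 2 ≤ n)
    (h0 : ∀ k, |ε k - sqDispersion k| ≤ δ₀)
    (h1 : ∀ k v, |fderiv ℝ ε k v - fderiv ℝ sqDispersion k v| ≤ δ₁ * (|v 0| + |v 1|)) (hδ₁ : 0 ≤ δ₁)
    (hc : 2 * δ₁ < 4 / π * c) {lev : ℝ} (hlev : lev ∈ Ioo (c ^ 2 + δ₀ - 4) (-2 - Real.sqrt 2 - δ₀)) :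
    ContDiff ℝ n (levelRadius ε lev) := by
  have h : ContDiff ℝ n ((fun p : ℝ × ℝ => levelRadius ε p.1 p.2) ∘ fun θ : ℝ => ((lev, θ) : ℝ × ℝ)) :=
    contDiff_iff_contDiffAt.2 fun θ =>
      (contDiffAt_levelRadius_uncurry hε hn h0 h1 hδ₁ hc hlev).comp θ (contDiff_prodMk_right lev).contDiffAt
  exact h

end Implicit


/-! ### §A5 The level curve differentiated twice: tangency, the Hessian identity, and the curvature -/

section Curve

variable {ε : (Fin 2 → ℝ) → ℝ} {u : ℝ → ℝ} {lev : ℝ}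

/-- The velocity of the polar curve `θ ↦ u(θ)e⃗_r(θ)`: `u'e⃗_r + u e⃗_t`. [folklore] -/
private theorem hasDerivAt_polarCurve (hu : Differentiable ℝ u) (θ : ℝ) :
    HasDerivAt (fun ϑ => u ϑ • dir ϑ) (deriv u θ • dir θ + u θ • dirPerp θ) θ := by
  have h := (hu θ).hasDerivAt.smul (hasDerivAt_dir_dirPerp θ)
  rw [add_comm] at h
  exact h

/-- **Tangency** `∇ε(p⃗)·p⃗' = 0` along a level curve `ε(u(θ)e⃗_r(θ)) = lev` (chain rule once). [folklore] -/
private theorem fderiv_polarCurve_velocity_eq_zero (hε : Differentiable ℝ ε) (hu : Differentiable ℝ u)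
    (hlevel : ∀ ϑ, ε (u ϑ • dir ϑ) = lev) (θ : ℝ) :
    fderiv ℝ ε (u θ • dir θ) (deriv u θ • dir θ + u θ • dirPerp θ) = 0 := by
  have hφ : HasDerivAt (fun ϑ => ε (u ϑ • dir ϑ))
      (fderiv ℝ ε (u θ • dir θ) (deriv u θ • dir θ + u θ • dirPerp θ)) θ :=
    (hε (u θ • dir θ)).hasFDerivAt.comp_hasDerivAt θ (hasDerivAt_polarCurve hu θ)
  have hφ0 : HasDerivAt (fun ϑ => ε (u ϑ • dir ϑ)) 0 θ := by
    rw [show (fun ϑ => ε (u ϑ • dir ϑ)) = fun _ => lev from funext hlevel]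
    exact hasDerivAt_const θ lev
  exact hφ.unique hφ0

/-- Tangency in the frame: `u'·(∇ε·e⃗_r) + u·(∇ε·e⃗_t) = 0`. [folklore] -/
private theorem tangency_frame (hε : Differentiable ℝ ε) (hu : Differentiable ℝ u)
    (hlevel : ∀ ϑ, ε (u ϑ • dir ϑ) = lev) (θ : ℝ) :
    deriv u θ * fderiv ℝ ε (u θ • dir θ) (dir θ) + u θ * fderiv ℝ ε (u θ • dir θ) (dirPerp θ) = 0 := by
  have h := fderiv_polarCurve_velocity_eq_zero hε hu hlevel θ
  rwa [map_add, map_smul, map_smul, smul_eq_mul, smul_eq_mul] at h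

/-- **The Hessian identity** `D²ε(p⃗)(p⃗', p⃗') + ∇ε(p⃗)·p⃗'' = 0` along a level curve (chain rule twice),
in the frame: `D²ε(p⃗)(p⃗',p⃗') + (u'' - u)(∇ε·e⃗_r) + 2u'(∇ε·e⃗_t) = 0`. [folklore] -/
private theorem hessian_identity_frame (hε : ContDiff ℝ 2 ε) (hu : ContDiff ℝ 2 u)
    (hlevel : ∀ ϑ, ε (u ϑ • dir ϑ) = lev) (θ : ℝ) :
    fderiv ℝ (fderiv ℝ ε) (u θ • dir θ) (deriv u θ • dir θ + u θ • dirPerp θ)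
        (deriv u θ • dir θ + u θ • dirPerp θ) +
      (deriv (deriv u) θ - u θ) * fderiv ℝ ε (u θ • dir θ) (dir θ) +
      2 * deriv u θ * fderiv ℝ ε (u θ • dir θ) (dirPerp θ) = 0 := by
  have hεd : Differentiable ℝ ε := hε.differentiable (by simp)
  have hud : Differentiable ℝ u := hu.differentiable (by simp)
  have hu' : Differentiable ℝ (deriv u) := by
    have h := (contDiff_succ_iff_deriv.1 (show ContDiff ℝ (1 + 1) u from hu)).2.2
    exact h.differentiable (by simp)
  have hfd : ∀ p, HasFDerivAt (fderiv ℝ ε) (fderiv ℝ (fderiv ℝ ε) p) p := fun p =>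
    (((hε.fderiv_right (m := 1) (by norm_num)).differentiable (by simp)) p).hasFDerivAt
  -- the velocity field and its derivative
  set v : ℝ → Fin 2 → ℝ := fun ϑ => deriv u ϑ • dir ϑ + u ϑ • dirPerp ϑ with hv
  have hvd : HasDerivAt v ((deriv (deriv u) θ • dir θ + deriv u θ • dirPerp θ) +
      (deriv u θ • dirPerp θ + u θ • (-dir θ))) θ := by
    have h1 : HasDerivAt (fun ϑ => deriv u ϑ • dir ϑ) (deriv (deriv u) θ • dir θ + deriv u θ • dirPerp θ) θ := by
      have h := (hu' θ).hasDerivAt.smul (hasDerivAt_dir_dirPerp θ)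
      rw [add_comm] at h; exact h
    have h2 : HasDerivAt (fun ϑ => u ϑ • dirPerp ϑ) (deriv u θ • dirPerp θ + u θ • (-dir θ)) θ := by
      have h := (hud θ).hasDerivAt.smul (hasDerivAt_dirPerp θ)
      rw [add_comm] at h; exact h
    exact h1.add h2
  -- `c(ϑ) = ∇ε(p(ϑ))`, `c' = D²ε(p)(p')`
  have hcd : HasDerivAt (fun ϑ => fderiv ℝ ε (u ϑ • dir ϑ))
      (fderiv ℝ (fderiv ℝ ε) (u θ • dir θ) (v θ)) θ :=
    (hfd (u θ • dir θ)).comp_hasDerivAt θ (hasDerivAt_polarCurve hud θ)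
  have hψ : HasDerivAt (fun ϑ => fderiv ℝ ε (u ϑ • dir ϑ) (v ϑ))
      (fderiv ℝ (fderiv ℝ ε) (u θ • dir θ) (v θ) (v θ) +
        fderiv ℝ ε (u θ • dir θ) ((deriv (deriv u) θ • dir θ + deriv u θ • dirPerp θ) +
          (deriv u θ • dirPerp θ + u θ • (-dir θ)))) θ := hcd.clm_apply hvd
  have hψ0 : HasDerivAt (fun ϑ => fderiv ℝ ε (u ϑ • dir ϑ) (v ϑ)) 0 θ := by
    have : (fun ϑ => fderiv ℝ ε (u ϑ • dir ϑ) (v ϑ)) = fun _ => (0 : ℝ) :=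
      funext fun ϑ => fderiv_polarCurve_velocity_eq_zero hεd hud hlevel ϑ
    rw [this]; exact hasDerivAt_const θ (0 : ℝ)
  have h := hψ.unique hψ0
  simp only [hv, map_add, map_smul, map_neg, smul_eq_mul] at h ⊢
  linarith

/-- **The polar curvature from the Hessian** (pure algebra of the two identities): if `u, a > 0`,
`u'a + ub = 0`, `Q + (u'' - u)a + 2u'b = 0`, `Q ≥ λ(u² + u'²)` and `a² + b² ≤ M²`, then
`(u² + 2u'² - uu'')/(u² + u'²)^{3/2} ≥ λ/M`. [folklore] -/
private theorem curvature_algebra {u a b u' u'' Q lam M : ℝ} (hu : 0 < u) (ha : 0 < a) (hlam : 0 < lam)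
    (hM : 0 < M) (I1 : u' * a + u * b = 0) (I2 : Q + (u'' - u) * a + 2 * u' * b = 0)
    (hQ : lam * (u ^ 2 + u' ^ 2) ≤ Q) (hab : a ^ 2 + b ^ 2 ≤ M ^ 2) :
    lam / M ≤ (u ^ 2 + 2 * u' ^ 2 - u * u'') / Real.sqrt (u ^ 2 + u' ^ 2) ^ 3 := by
  set S := u ^ 2 + u' ^ 2 with hS
  have hSpos : 0 < S := by positivity
  have hb : b = -(u' * a) / u := by field_simp; linarith
  have hu' : u' = -(u * b) / a := by field_simp; linarith
  -- the numerator is `uQ/a`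
  have hN : u ^ 2 + 2 * u' ^ 2 - u * u'' = u * Q / a := by
    have hQ' : Q = (u - u'') * a - 2 * u' * b := by linarith
    rw [hQ', hb]
    field_simp
    ring
  -- `S = u²(a² + b²)/a² ≤ (uM/a)²`, so `√S ≤ uM/a`
  have hSeq : S = u ^ 2 * (a ^ 2 + b ^ 2) / a ^ 2 := by
    rw [hS, hu']; field_simp
  have hsqrt : Real.sqrt S ≤ u * M / a := by
    have hle : S ≤ (u * M / a) ^ 2 := by
      rw [hSeq, div_pow, mul_pow]
      gcongr
    calc Real.sqrt S ≤ Real.sqrt ((u * M / a) ^ 2) := Real.sqrt_le_sqrt hle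
      _ = u * M / a := Real.sqrt_sq (by positivity)
  have hsqrt_pos : 0 < Real.sqrt S := Real.sqrt_pos.2 hSpos
  have h3 : Real.sqrt S ^ 3 = S * Real.sqrt S := by
    rw [pow_succ, Real.sq_sqrt hSpos.le]
  rw [h3, hN, div_le_div_iff₀ hM (by positivity)]
  -- `λ · S · √S ≤ λ S · uM/a ≤ (uQ/a) · M`
  have h4 : lam * (S * Real.sqrt S) ≤ lam * (S * (u * M / a)) := by gcongr
  have h5 : lam * (S * (u * M / a)) = (u * (lam * S) / a) * M := by ring
  have h6 : u * (lam * S) / a * M ≤ u * Q / a * M := by gcongr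
  linarith

/-- **Convexity of the level curve from the Hessian.** If along the `C²` level curve
`ε(u(θ)e⃗_r(θ)) = lev` one has `u(θ) > 0`, `∇ε(p⃗)·e⃗_r > 0`, `(∇ε·e⃗_r)² + (∇ε·e⃗_t)² ≤ M²` and
`D²ε(p⃗)(w, w) ≥ λ|w|²`, then `1/r(θ) = polarCurvature u θ ≥ λ/M` — BGM: "the curvature radius is
computed in terms of the first two derivatives of `ε_h`". [cite: BenfattoGiulianiMastropietro2006, §2.4 proof of Lemma 2.1 p0009:L95–L99] -/
theorem le_polarCurvature_of_hessian (hε : ContDiff ℝ 2 ε) (hu : ContDiff ℝ 2 u)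
    (hlevel : ∀ ϑ, ε (u ϑ • dir ϑ) = lev) {θ lam M : ℝ} (hlam : 0 < lam) (hM : 0 < M)
    (hupos : 0 < u θ) (ha : 0 < fderiv ℝ ε (u θ • dir θ) (dir θ))
    (hab : fderiv ℝ ε (u θ • dir θ) (dir θ) ^ 2 + fderiv ℝ ε (u θ • dir θ) (dirPerp θ) ^ 2 ≤ M ^ 2)
    (hQ : ∀ w : Fin 2 → ℝ, lam * (w 0 ^ 2 + w 1 ^ 2) ≤ fderiv ℝ (fderiv ℝ ε) (u θ • dir θ) w w) :
    lam / M ≤ polarCurvature u θ := by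
  have hεd : Differentiable ℝ ε := hε.differentiable (by simp)
  have hud : Differentiable ℝ u := hu.differentiable (by simp)
  have I1 := tangency_frame hεd hud hlevel θ
  have I2 := hessian_identity_frame hε hu hlevel θ
  have hQ' := hQ (deriv u θ • dir θ + u θ • dirPerp θ)
  rw [sq_add_sq_frame] at hQ'
  rw [polarCurvature, polarSpeed]
  have h := curvature_algebra (u := u θ) (u' := deriv u θ) (u'' := deriv (deriv u) θ) hupos ha hlam hM
    I1 I2 (by linarith [hQ']) hab
  exact h

end Curve

/-! ### §A6 Sums of points of bounded Euclidean radius -/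

/-- `√(v₁² + v₂²)` is the norm of the complex number `v₁ + iv₂`. [folklore] -/
private theorem sqrt_sq_add_sq_eq_norm_momToComplex (v : Fin 2 → ℝ) :
    Real.sqrt (v 0 ^ 2 + v 1 ^ 2) = ‖momToComplex v‖ := by
  rw [← norm_momToComplex_sq, Real.sqrt_sq (norm_nonneg _)]

/-- **Triangle inequality for the Euclidean norm of a sum of `N` plane vectors of radius `≤ R`.** [folklore] -/
private theorem sqrt_sq_sum_le {N : ℕ} (k : Fin N → Fin 2 → ℝ) {R : ℝ}
    (hR : ∀ j, Real.sqrt (k j 0 ^ 2 + k j 1 ^ 2) ≤ R) :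
    Real.sqrt ((∑ j, k j 0) ^ 2 + (∑ j, k j 1) ^ 2) ≤ N * R := by
  have hz : Real.sqrt ((∑ j, k j 0) ^ 2 + (∑ j, k j 1) ^ 2) = ‖∑ j, momToComplex (k j)‖ := by
    rw [Complex.norm_eq_sqrt_sq_add_sq, Complex.re_sum, Complex.im_sum]
    simp only [momToComplex_re, momToComplex_im]
  rw [hz]
  calc ‖∑ j, momToComplex (k j)‖ ≤ ∑ j, ‖momToComplex (k j)‖ := norm_sum_le _ _
    _ ≤ ∑ _j : Fin N, R := Finset.sum_le_sum fun j _ => by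
        rw [← sqrt_sq_add_sq_eq_norm_momToComplex]; exact hR j
    _ = N * R := by simp


/-! ### §B1 Linear-algebra and summation helpers for the instantiation -/

/-- A plane vector in the coordinate basis. [folklore] -/
private theorem eq_smul_single_add (v : Fin 2 → ℝ) :
    v = v 0 • (Pi.single 0 (1 : ℝ) : Fin 2 → ℝ) + v 1 • (Pi.single 1 (1 : ℝ) : Fin 2 → ℝ) := by
  funext i
  fin_cases i <;> simp

/-- A linear functional bounded by `B` on the coordinate basis is bounded by `B(|v₁| + |v₂|)`. [folklore] -/
private theorem norm_clm_apply_le_basis {F : Type*} [NormedAddCommGroup F] [NormedSpace ℝ F]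
    (L : (Fin 2 → ℝ) →L[ℝ] F) {B : ℝ} (h0 : ‖L (Pi.single 0 1)‖ ≤ B) (h1 : ‖L (Pi.single 1 1)‖ ≤ B)
    (v : Fin 2 → ℝ) : ‖L v‖ ≤ B * (|v 0| + |v 1|) := by
  have hB : 0 ≤ B := (norm_nonneg _).trans h0
  conv_lhs => rw [eq_smul_single_add v]
  rw [map_add, map_smul, map_smul]
  calc ‖v 0 • L (Pi.single 0 1) + v 1 • L (Pi.single 1 1)‖
      ≤ ‖v 0 • L (Pi.single 0 1)‖ + ‖v 1 • L (Pi.single 1 1)‖ := norm_add_le _ _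
    _ = |v 0| * ‖L (Pi.single 0 1)‖ + |v 1| * ‖L (Pi.single 1 1)‖ := by
        rw [norm_smul, norm_smul, Real.norm_eq_abs, Real.norm_eq_abs]
    _ ≤ |v 0| * B + |v 1| * B := by gcongr
    _ = B * (|v 0| + |v 1|) := by ring

/-- A bilinear form bounded by `B` on pairs of coordinate vectors is bounded by
`B(|v₁| + |v₂|)(|w₁| + |w₂|)`. [folklore] -/
private theorem norm_bilin_apply_le_basis {F : Type*} [NormedAddCommGroup F] [NormedSpace ℝ F]
    (L : (Fin 2 → ℝ) →L[ℝ] (Fin 2 → ℝ) →L[ℝ] F) {B : ℝ}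
    (h : ∀ i l : Fin 2, ‖L (Pi.single i 1) (Pi.single l 1)‖ ≤ B) (v w : Fin 2 → ℝ) :
    ‖L v w‖ ≤ B * (|v 0| + |v 1|) * (|w 0| + |w 1|) := by
  have hB : 0 ≤ B := (norm_nonneg _).trans (h 0 0)
  have hv : ‖L v w‖ ≤ (B * (|w 0| + |w 1|)) * (|v 0| + |v 1|) := by
    have key : ∀ i : Fin 2, ‖L (Pi.single i 1) w‖ ≤ B * (|w 0| + |w 1|) := fun i =>
      norm_clm_apply_le_basis (L (Pi.single i 1)) (h i 0) (h i 1) w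
    conv_lhs => rw [eq_smul_single_add v]
    rw [map_add, map_smul, map_smul, add_apply, smul_apply, smul_apply]
    calc ‖v 0 • L (Pi.single 0 1) w + v 1 • L (Pi.single 1 1) w‖
        ≤ ‖v 0 • L (Pi.single 0 1) w‖ + ‖v 1 • L (Pi.single 1 1) w‖ := norm_add_le _ _
      _ = |v 0| * ‖L (Pi.single 0 1) w‖ + |v 1| * ‖L (Pi.single 1 1) w‖ := by
          rw [norm_smul, norm_smul, Real.norm_eq_abs, Real.norm_eq_abs]
      _ ≤ |v 0| * (B * (|w 0| + |w 1|)) + |v 1| * (B * (|w 0| + |w 1|)) := by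
          gcongr
          · exact key 0
          · exact key 1
      _ = (B * (|w 0| + |w 1|)) * (|v 0| + |v 1|) := by ring
  calc ‖L v w‖ ≤ (B * (|w 0| + |w 1|)) * (|v 0| + |v 1|) := hv
    _ = B * (|v 0| + |v 1|) * (|w 0| + |w 1|) := by ring

/-- `m · 4^{-m} ≤ (1/2)^m`. [folklore] -/
private theorem mul_zpow_neg_le_half_pow (m : ℕ) : (m : ℝ) * (4 : ℝ) ^ (-(m : ℤ)) ≤ (1 / 2 : ℝ) ^ m := by
  have hm : (m : ℝ) ≤ 2 ^ m := by exact_mod_cast (Nat.lt_two_pow_self).le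
  rw [zpow_neg, zpow_natCast]
  have h4 : (4 : ℝ) ^ m = 2 ^ m * 2 ^ m := by rw [← mul_pow]; norm_num
  rw [h4, one_div, inv_pow]
  have h2 : (0 : ℝ) < 2 ^ m := by positivity
  rw [mul_inv, ← mul_assoc]
  calc (m : ℝ) * (2 ^ m)⁻¹ * (2 ^ m)⁻¹ ≤ 2 ^ m * (2 ^ m)⁻¹ * (2 ^ m)⁻¹ := by gcongr
    _ = (2 ^ m)⁻¹ := by rw [mul_inv_cancel₀ h2.ne', one_mul]

/-- `m · 4^{-2m} ≤ (1/2)^m`. [folklore] -/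
private theorem mul_zpow_neg_two_le_half_pow (m : ℕ) :
    (m : ℝ) * (4 : ℝ) ^ (2 * (-(m : ℤ))) ≤ (1 / 2 : ℝ) ^ m := by
  have h1 := mul_zpow_neg_le_half_pow m
  have hle : (4 : ℝ) ^ (2 * (-(m : ℤ))) ≤ (4 : ℝ) ^ (-(m : ℤ)) := by
    apply zpow_le_zpow_right₀ (by norm_num : (1 : ℝ) ≤ 4)
    omega
  exact (mul_le_mul_of_nonneg_left hle (Nat.cast_nonneg m)).trans h1

/-- `Σ_{m<n} m 4^{-m} ≤ 2`. [folklore] -/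
private theorem sum_mul_zpow_neg_le (n : ℕ) : ∑ m ∈ Finset.range n, (m : ℝ) * (4 : ℝ) ^ (-(m : ℤ)) ≤ 2 :=
  (Finset.sum_le_sum fun m _ => mul_zpow_neg_le_half_pow m).trans (sum_geometric_two_le n)

/-- `Σ_{m<n} m 4^{-2m} ≤ 2`. [folklore] -/
private theorem sum_mul_zpow_neg_two_le (n : ℕ) :
    ∑ m ∈ Finset.range n, (m : ℝ) * (4 : ℝ) ^ (2 * (-(m : ℤ))) ≤ 2 :=
  (Finset.sum_le_sum fun m _ => mul_zpow_neg_two_le_half_pow m).trans (sum_geometric_two_le n)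

/-- `Σ_{m<n} m ≤ n²` (BGM: `Σ_{j=h+1}^0 |j| ≤ c₀²/U₀²` is where `c₀ = |h_β|U₀` enters (2.41a)). [folklore] -/
private theorem sum_range_cast_le_sq (n : ℕ) : ∑ m ∈ Finset.range n, (m : ℝ) ≤ (n : ℝ) ^ 2 := by
  calc ∑ m ∈ Finset.range n, (m : ℝ) ≤ ∑ _m ∈ Finset.range n, (n : ℝ) :=
        Finset.sum_le_sum fun m hm => by exact_mod_cast (Finset.mem_range.1 hm).le
    _ = (n : ℝ) ^ 2 := by simp [sq]

/-- The Matsubara frequencies `±π/β` (the two entering `ε_h`, (2.36c)) belong to `D_β`. [folklore] -/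
private theorem pi_div_mem_matsubaraSet (β : ℝ) : π / β ∈ matsubaraSet β :=
  ⟨0, by simp [fermiMatsubara]⟩

/-- Companion of `pi_div_mem_matsubaraSet`. [folklore] -/
private theorem neg_pi_div_mem_matsubaraSet (β : ℝ) : -(π / β) ∈ matsubaraSet β :=
  ⟨-1, by simp [fermiMatsubara]; ring⟩

/-- The order-zero discrete time derivative is the identity ((2.36aa) with `a = 0`). [folklore] -/
private theorem bgmTimeDiffIter_zero (β : ℝ) (f : ℝ × (Fin 2 → ℝ) → ℂ) : bgmTimeDiffIter β 0 f = f := rfl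


/-! ### §B2 Derivatives of `k⃗ ↦ Re(a · Σₘ gₘ(k⃗))` through the derivatives of the `gₘ` -/

section ReSum

variable {n : ℕ} {g : ℕ → (Fin 2 → ℝ) → ℂ} (hg : ∀ m, ContDiff ℝ 2 (g m)) (a : ℝ)
include hg

/-- `Re(a Σₘ gₘ)` is `C²`. [folklore] -/
private theorem contDiff_re_smul_sum : ContDiff ℝ 2 (fun k => (a • ∑ m ∈ Finset.range n, g m k).re) :=
  Complex.reCLM.contDiff.comp ((ContDiff.sum fun m _ => hg m).const_smul a)

/-- The iterated derivatives of `Re(a Σₘ gₘ)` are `Re(a Σₘ ·)` of those of the `gₘ`. [folklore] -/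
private theorem iteratedFDeriv_re_smul_sum {b : ℕ} (hb : b ≤ 2) (k : Fin 2 → ℝ) (M : Fin b → Fin 2 → ℝ) :
    iteratedFDeriv ℝ b (fun k => (a • ∑ m ∈ Finset.range n, g m k).re) k M =
      (a • ∑ m ∈ Finset.range n, iteratedFDeriv ℝ b (g m) k M).re := by
  have hS : ContDiff ℝ 2 (fun k => ∑ m ∈ Finset.range n, g m k) := ContDiff.sum fun m _ => hg m
  have hΦ : ContDiff ℝ 2 (fun k => a • ∑ m ∈ Finset.range n, g m k) := hS.const_smul a
  have hb' : ((b : ℕ) : WithTop ℕ∞) ≤ 2 := by exact_mod_cast hb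
  have h1 : (fun k => (a • ∑ m ∈ Finset.range n, g m k).re) =
      ⇑Complex.reCLM ∘ (fun k => a • ∑ m ∈ Finset.range n, g m k) := rfl
  rw [h1, Complex.reCLM.iteratedFDeriv_comp_left hΦ.contDiffAt hb']
  have h2 : (fun k => a • ∑ m ∈ Finset.range n, g m k) = a • (fun k => ∑ m ∈ Finset.range n, g m k) := rfl
  rw [h2, iteratedFDeriv_const_smul_apply (hS.of_le hb').contDiffAt]
  have h3 := congrFun (iteratedFDeriv_sum (𝕜 := ℝ) (i := b) (u := Finset.range n) (f := g)
    (fun m _ => (hg m).of_le hb')) k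
  rw [h3, Finset.sum_apply, ContinuousLinearMap.compContinuousMultilinearMap_coe, Function.comp_apply,
    smul_apply, sum_apply, Complex.reCLM_apply]

/-- First derivative: `D[Re(a Σₘ gₘ)](k)v = Re(a Σₘ Dgₘ(k)v)`. [folklore] -/
private theorem fderiv_re_smul_sum (k v : Fin 2 → ℝ) :
    fderiv ℝ (fun k => (a • ∑ m ∈ Finset.range n, g m k).re) k v =
      (a • ∑ m ∈ Finset.range n, fderiv ℝ (g m) k v).re := by
  have h := iteratedFDeriv_re_smul_sum (n := n) hg a (b := 1) (by norm_num) k (fun _ => v)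
  simp only [iteratedFDeriv_one_apply] at h
  exact h

/-- Second derivative: `D²[Re(a Σₘ gₘ)](k)(v, w) = Re(a Σₘ D²gₘ(k)(v, w))`. [folklore] -/
private theorem fderiv_fderiv_re_smul_sum (k v w : Fin 2 → ℝ) :
    fderiv ℝ (fderiv ℝ (fun k => (a • ∑ m ∈ Finset.range n, g m k).re)) k v w =
      (a • ∑ m ∈ Finset.range n, fderiv ℝ (fderiv ℝ (g m)) k v w).re := by
  have h := iteratedFDeriv_re_smul_sum (n := n) hg a (b := 2) le_rfl k ![v, w]
  simp only [iteratedFDeriv_two_apply, Matrix.cons_val_zero, Matrix.cons_val_one] at h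
  exact h

end ReSum

/-- Adding a `C²` perturbation adds its first derivative. [folklore] -/
private theorem fderiv_add_apply' {F : Type*} [NormedAddCommGroup F] [NormedSpace ℝ F] {f g : (Fin 2 → ℝ) → F}
    (hf : ContDiff ℝ 2 f) (hg : ContDiff ℝ 2 g) (k v : Fin 2 → ℝ) :
    fderiv ℝ (fun k => f k + g k) k v = fderiv ℝ f k v + fderiv ℝ g k v := by
  have h := iteratedFDeriv_add_apply (i := 1) (x := k) (hf.of_le (by norm_num)).contDiffAt
    (hg.of_le (by norm_num)).contDiffAt
  have h' := congrArg (fun T => T (fun _ => v)) h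
  simp only [iteratedFDeriv_one_apply, add_apply] at h'
  exact h'

/-- Adding a `C²` perturbation adds its second derivative. [folklore] -/
private theorem fderiv_fderiv_add_apply' {F : Type*} [NormedAddCommGroup F] [NormedSpace ℝ F]
    {f g : (Fin 2 → ℝ) → F} (hf : ContDiff ℝ 2 f) (hg : ContDiff ℝ 2 g) (k v w : Fin 2 → ℝ) :
    fderiv ℝ (fderiv ℝ (fun k => f k + g k)) k v w =
      fderiv ℝ (fderiv ℝ f) k v w + fderiv ℝ (fderiv ℝ g) k v w := by
  have h := iteratedFDeriv_add_apply (i := 2) (x := k) hf.contDiffAt hg.contDiffAt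
  have h' := congrArg (fun T => T ![v, w]) h
  simp only [iteratedFDeriv_two_apply, add_apply, Matrix.cons_val_zero,
    Matrix.cons_val_one] at h'
  exact h'


/-! ### §B3 The scale-`h` effective dispersion `ε_h` is a `C²`-small perturbation of `ε₀` ((2.41a)) -/

section EffDisp

variable {β U : ℝ} {C : ℕ → ℝ} {hβ : ℤ} {E : ℤ → ℝ × (Fin 2 → ℝ) → ℂ}

/-- `-(m + 1) = -m - 1` through the casts. [folklore] -/
private theorem neg_natCast_succ (m : ℕ) : (-((m + 1 : ℕ) : ℤ)) = -(m : ℤ) - 1 := by push_cast; ring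

/-- **Telescoping**: `E_h = E_0 - Σ_{j=h+1}^{0} (E_j - E_{j-1})` (BGM: "we can write
`ε_h = ε_0 + Σ_{j=h+1}^0 (ε_{j-1} - ε_j)`"), indexed by `m = -j ∈ {0, …, |h| - 1}`.
[cite: BenfattoGiulianiMastropietro2006, §2.4 proof of Lemma 2.1 p0009:L77] -/
theorem bgm_telescope (E : ℤ → ℝ × (Fin 2 → ℝ) → ℂ) {h : ℤ} (hh : h ≤ 0) (p : ℝ × (Fin 2 → ℝ)) :
    E h p = E 0 p - ∑ m ∈ Finset.range (-h).toNat, (E (-(m : ℤ)) p - E (-(m : ℤ) - 1) p) := by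
  have h1 := Finset.sum_range_sub' (fun m : ℕ => E (-(m : ℤ)) p) (-h).toNat
  have hn : (((-h).toNat : ℕ) : ℤ) = -h := Int.toNat_of_nonneg (by omega)
  have h2 : ∀ m : ℕ, E (-((m + 1 : ℕ) : ℤ)) p = E (-(m : ℤ) - 1) p := fun m => by rw [neg_natCast_succ]
  simp only [h2] at h1
  rw [h1, hn, neg_neg, Nat.cast_zero, neg_zero]
  ring

/-- **The inductive bounds (2.36) at scale `j = -m`**, read off `BGMSmoothness` for the three orders
used by Lemma 2.1: `|E_j - E_{j-1}| ≤ C₀|U||j|γ^{2j}`, `|∂(E_j - E_{j-1})| ≤ C₁U²|j|γ^{j}`,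
`|∂²(E_j - E_{j-1})| ≤ C₂U²|j|` (on the coordinate directions). [cite: BenfattoGiulianiMastropietro2006, §2.3 (2.36) p0008:L46] -/
theorem bgm_diff_bounds (hS : BGMSmoothness β U C hβ E) {m : ℕ} (hm : hβ ≤ -(m : ℤ))
    {k₀ : ℝ} (hk₀ : k₀ ∈ matsubaraSet β) (k : Fin 2 → ℝ) :
    ‖E (-(m : ℤ)) (k₀, k) - E (-(m : ℤ) - 1) (k₀, k)‖ ≤ |C 0| * |U| * ((m : ℝ) * (4 : ℝ) ^ (2 * (-(m : ℤ)))) ∧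
    (∀ i : Fin 2, ‖fderiv ℝ (fun k => E (-(m : ℤ)) (k₀, k) - E (-(m : ℤ) - 1) (k₀, k)) k (Pi.single i 1)‖
        ≤ |C 1| * U ^ 2 * ((m : ℝ) * (4 : ℝ) ^ (-(m : ℤ)))) ∧
    (∀ i l : Fin 2, ‖fderiv ℝ (fderiv ℝ (fun k => E (-(m : ℤ)) (k₀, k) - E (-(m : ℤ) - 1) (k₀, k))) k
        (Pi.single i 1) (Pi.single l 1)‖ ≤ |C 2| * U ^ 2 * (m : ℝ)) := by
  obtain ⟨-, -, hS3⟩ := hS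
  obtain ⟨hb0, hbd⟩ := hS3 (-(m : ℤ)) hm (by omega)
  have hcast : |(((-(m : ℤ)) : ℤ) : ℝ)| = m := by push_cast; rw [abs_neg, Nat.abs_cast]
  have hmpos : (0 : ℝ) ≤ m := Nat.cast_nonneg m
  refine ⟨?_, fun i => ?_, fun i l => ?_⟩
  · have h := hb0 k₀ hk₀ k
    rw [hcast] at h
    calc _ ≤ C 0 * |U| * m * (4 : ℝ) ^ (2 * (-(m : ℤ))) := h
      _ = C 0 * (|U| * (m * (4 : ℝ) ^ (2 * (-(m : ℤ))))) := by ring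
      _ ≤ |C 0| * (|U| * (m * (4 : ℝ) ^ (2 * (-(m : ℤ))))) :=
          mul_le_mul_of_nonneg_right (le_abs_self _) (by positivity)
      _ = _ := by ring
  · have h := hbd 0 1 (by norm_num) (fun _ => i) k₀ hk₀ k
    have e : mixedPartial (fun _ : Fin 1 => i)
        (fun k' => bgmTimeDiffIter β 0 (fun q => E (-(m : ℤ)) q - E (-(m : ℤ) - 1) q) (k₀, k')) k =
        fderiv ℝ (fun k => E (-(m : ℤ)) (k₀, k) - E (-(m : ℤ) - 1) (k₀, k)) k (Pi.single i 1) := by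
      simp only [mixedPartial, bgmTimeDiffIter_zero, iteratedFDeriv_one_apply]
    have hexp : (2 - ((0 + 1 : ℕ) : ℤ)) * (-(m : ℤ)) = -(m : ℤ) := by push_cast; ring
    rw [e, hcast, hexp, zero_add] at h
    calc _ ≤ C 1 * |U| ^ 2 * m * (4 : ℝ) ^ (-(m : ℤ)) := h
      _ = C 1 * (U ^ 2 * (m * (4 : ℝ) ^ (-(m : ℤ)))) := by rw [sq_abs]; ring
      _ ≤ |C 1| * (U ^ 2 * (m * (4 : ℝ) ^ (-(m : ℤ)))) :=
          mul_le_mul_of_nonneg_right (le_abs_self _) (by positivity)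
      _ = _ := by ring
  · have h := hbd 0 2 (by norm_num) ![i, l] k₀ hk₀ k
    have e : mixedPartial ![i, l]
        (fun k' => bgmTimeDiffIter β 0 (fun q => E (-(m : ℤ)) q - E (-(m : ℤ) - 1) q) (k₀, k')) k =
        fderiv ℝ (fderiv ℝ (fun k => E (-(m : ℤ)) (k₀, k) - E (-(m : ℤ) - 1) (k₀, k))) k
          (Pi.single i 1) (Pi.single l 1) := by
      simp only [mixedPartial, bgmTimeDiffIter_zero, iteratedFDeriv_two_apply, Matrix.cons_val_zero,
        Matrix.cons_val_one]
    have hexp : (2 - ((0 + 2 : ℕ) : ℤ)) * (-(m : ℤ)) = 0 := by push_cast; ring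
    rw [e, hcast, hexp, zpow_zero, mul_one, zero_add] at h
    calc _ ≤ C 2 * |U| ^ 2 * m := h
      _ = C 2 * (U ^ 2 * m) := by rw [sq_abs]; ring
      _ ≤ |C 2| * (U ^ 2 * m) := mul_le_mul_of_nonneg_right (le_abs_self _) (by positivity)
      _ = _ := by ring

/-- The real part of the averaged, telescoped slices. [folklore] -/
private theorem re_half_sum_identity (s : ℝ) (A B : ℂ) :
    ((((s : ℂ) - A) + ((s : ℂ) - B)) / 2).re = s + ((-(1 / 2 : ℝ)) • (A + B)).re := by
  rw [Complex.real_smul]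
  have : (((s : ℂ) - A) + ((s : ℂ) - B)) / 2 = (s : ℂ) + (((-(1 / 2 : ℝ)) : ℝ) : ℂ) * (A + B) := by
    push_cast; ring
  rw [this, Complex.add_re, Complex.ofReal_re]

/-- **(2.41a) — `ε_h` is a `C²`-small perturbation of `ε₀`.**  Under `E_0 ≡ ε₀` and the inductive
hypothesis (2.36) for `h_β ≤ h ≤ 0`: `ε_h ∈ C²` and, for all `k⃗`,
`|ε_h - ε₀| ≤ 2C₀|U|`, `|∇(ε_h - ε₀)·v| ≤ 2C₁U²(|v₁| + |v₂|)`,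
`|D²(ε_h - ε₀)(v, w)| ≤ C₂(U h)²(|v₁| + |v₂|)(|w₁| + |w₂|)` — BGM's
`|ε_h - ε_0| ≤ C₀|U|Σ|j|γ^{2j}`, `|∇ε_h - ∇ε_0| ≤ 2C₁U²Σγ^j|j|`, `|∂²ε_h - ∂²ε_0| ≤ C₂U²Σ|j| ≤ C₂c₀²`,
with the elementary sums `Σ_{m≥0} m4^{-m}, Σ m4^{-2m} ≤ 2`, `Σ_{m<|h|} m ≤ h²`.
[cite: BenfattoGiulianiMastropietro2006, §2.4 (2.41a) p0009:L77–L84] -/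
theorem bgmEffDisp_perturbation (hI : BGMInitial E) (hS : BGMSmoothness β U C hβ E) {h : ℤ}
    (hh₁ : hβ ≤ h) (hh₀ : h ≤ 0) :
    ContDiff ℝ 2 (bgmEffDisp β E h) ∧
    (∀ k, |bgmEffDisp β E h k - sqDispersion k| ≤ 2 * |C 0| * |U|) ∧
    (∀ k v, |fderiv ℝ (bgmEffDisp β E h) k v - fderiv ℝ sqDispersion k v| ≤
        2 * |C 1| * U ^ 2 * (|v 0| + |v 1|)) ∧
    (∀ k v w, |fderiv ℝ (fderiv ℝ (bgmEffDisp β E h)) k v w - fderiv ℝ (fderiv ℝ sqDispersion) k v w| ≤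
        |C 2| * (U * h) ^ 2 * (|v 0| + |v 1|) * (|w 0| + |w 1|)) := by
  have hS1 := hS.1
  set n := (-h).toNat with hn
  have hnz : ((n : ℕ) : ℤ) = -h := Int.toNat_of_nonneg (by omega)
  have hnr : (n : ℝ) = -(h : ℝ) := by exact_mod_cast hnz
  have hmem : ∀ m ∈ Finset.range n, hβ ≤ -(m : ℤ) := fun m hm => by
    have := Finset.mem_range.1 hm; omega
  have ha := pi_div_mem_matsubaraSet β
  have hna := neg_pi_div_mem_matsubaraSet β
  -- the summands `g_m = (E_{-m} - E_{-m-1})(π/β, ·) + (E_{-m} - E_{-m-1})(-π/β, ·)`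
  set g : ℕ → (Fin 2 → ℝ) → ℂ := fun m k =>
    (E (-(m : ℤ)) (π / β, k) - E (-(m : ℤ) - 1) (π / β, k)) +
      (E (-(m : ℤ)) (-(π / β), k) - E (-(m : ℤ) - 1) (-(π / β), k)) with hg
  have hslice : ∀ (j : ℤ) (k₀ : ℝ), ContDiff ℝ 2 (fun k => E j (k₀, k)) := fun j k₀ => hS1 j k₀ 2
  have hdd : ∀ (m : ℕ) (k₀ : ℝ), ContDiff ℝ 2 (fun k => E (-(m : ℤ)) (k₀, k) - E (-(m : ℤ) - 1) (k₀, k)) :=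
    fun m k₀ => (hslice _ _).sub (hslice _ _)
  have hgd : ∀ m, ContDiff ℝ 2 (g m) := fun m => (hdd m _).add (hdd m _)
  -- the identity `ε_h = ε₀ + Re(-(1/2) Σ g)`
  have hε : bgmEffDisp β E h = fun k => sqDispersion k +
      ((-(1 / 2 : ℝ)) • ∑ m ∈ Finset.range n, g m k).re := by
    funext k
    rw [bgmEffDisp, bgm_telescope E hh₀ (π / β, k), bgm_telescope E hh₀ (-(π / β), k), hI, hI]
    simp only [hg, Finset.sum_add_distrib]
    exact re_half_sum_identity _ _ _
  have hηd : ContDiff ℝ 2 (fun k => ((-(1 / 2 : ℝ)) • ∑ m ∈ Finset.range n, g m k).re) :=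
    contDiff_re_smul_sum hgd _
  have hεd : ContDiff ℝ 2 (bgmEffDisp β E h) := by
    rw [hε]; exact contDiff_sqDispersion.add hηd
  have hnorm_smul : ∀ z : ℂ, |((-(1 / 2 : ℝ)) • z).re| ≤ 1 / 2 * ‖z‖ := fun z => by
    calc |((-(1 / 2 : ℝ)) • z).re| ≤ ‖(-(1 / 2 : ℝ)) • z‖ := Complex.abs_re_le_norm _
      _ = 1 / 2 * ‖z‖ := by rw [norm_smul, Real.norm_eq_abs]; norm_num
  refine ⟨hεd, fun k => ?_, fun k v => ?_, fun k v w => ?_⟩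
  · -- order zero
    rw [hε]
    simp only [add_sub_cancel_left]
    refine (hnorm_smul _).trans ?_
    have hterm : ∀ m ∈ Finset.range n, ‖g m k‖ ≤ 2 * (|C 0| * |U|) * ((m : ℝ) * (4 : ℝ) ^ (2 * (-(m : ℤ)))) := by
      intro m hm
      have h1 := (bgm_diff_bounds hS (hmem m hm) ha k).1
      have h2 := (bgm_diff_bounds hS (hmem m hm) hna k).1
      calc ‖g m k‖ ≤ _ + _ := norm_add_le _ _
        _ ≤ _ := by linarith
    calc 1 / 2 * ‖∑ m ∈ Finset.range n, g m k‖ ≤ 1 / 2 * ∑ m ∈ Finset.range n, ‖g m k‖ := by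
          gcongr; exact norm_sum_le _ _
      _ ≤ 1 / 2 * ∑ m ∈ Finset.range n, 2 * (|C 0| * |U|) * ((m : ℝ) * (4 : ℝ) ^ (2 * (-(m : ℤ)))) := by
          gcongr with m hm; exact hterm m hm
      _ = |C 0| * |U| * ∑ m ∈ Finset.range n, (m : ℝ) * (4 : ℝ) ^ (2 * (-(m : ℤ))) := by
          rw [← Finset.mul_sum]; ring
      _ ≤ |C 0| * |U| * 2 := by gcongr; exact sum_mul_zpow_neg_two_le n
      _ = 2 * |C 0| * |U| := by ring
  · -- order one
    rw [hε, fderiv_add_apply' contDiff_sqDispersion hηd, add_sub_cancel_left, fderiv_re_smul_sum hgd]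
    refine (hnorm_smul _).trans ?_
    have hterm : ∀ m ∈ Finset.range n, ‖fderiv ℝ (g m) k v‖ ≤
        2 * (|C 1| * U ^ 2 * (|v 0| + |v 1|)) * ((m : ℝ) * (4 : ℝ) ^ (-(m : ℤ))) := by
      intro m hm
      have h1 := (bgm_diff_bounds hS (hmem m hm) ha k).2.1
      have h2 := (bgm_diff_bounds hS (hmem m hm) hna k).2.1
      have e : fderiv ℝ (g m) k v =
          fderiv ℝ (fun k => E (-(m : ℤ)) (π / β, k) - E (-(m : ℤ) - 1) (π / β, k)) k v +
          fderiv ℝ (fun k => E (-(m : ℤ)) (-(π / β), k) - E (-(m : ℤ) - 1) (-(π / β), k)) k v :=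
        fderiv_add_apply' (hdd m _) (hdd m _) k v
      rw [e]
      have b1 := norm_clm_apply_le_basis _ (h1 0) (h1 1) v
      have b2 := norm_clm_apply_le_basis _ (h2 0) (h2 1) v
      calc _ ≤ _ + _ := norm_add_le _ _
        _ ≤ _ := by linarith
    calc 1 / 2 * ‖∑ m ∈ Finset.range n, fderiv ℝ (g m) k v‖
        ≤ 1 / 2 * ∑ m ∈ Finset.range n, ‖fderiv ℝ (g m) k v‖ := by gcongr; exact norm_sum_le _ _
      _ ≤ 1 / 2 * ∑ m ∈ Finset.range n, 2 * (|C 1| * U ^ 2 * (|v 0| + |v 1|)) * ((m : ℝ) * (4 : ℝ) ^ (-(m : ℤ))) := by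
          gcongr with m hm; exact hterm m hm
      _ = |C 1| * U ^ 2 * (|v 0| + |v 1|) * ∑ m ∈ Finset.range n, (m : ℝ) * (4 : ℝ) ^ (-(m : ℤ)) := by
          rw [← Finset.mul_sum]; ring
      _ ≤ |C 1| * U ^ 2 * (|v 0| + |v 1|) * 2 := by gcongr; exact sum_mul_zpow_neg_le n
      _ = 2 * |C 1| * U ^ 2 * (|v 0| + |v 1|) := by ring
  · -- order two
    rw [hε, fderiv_fderiv_add_apply' contDiff_sqDispersion hηd, add_sub_cancel_left,
      fderiv_fderiv_re_smul_sum hgd]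
    refine (hnorm_smul _).trans ?_
    have hterm : ∀ m ∈ Finset.range n, ‖fderiv ℝ (fderiv ℝ (g m)) k v w‖ ≤
        2 * (|C 2| * U ^ 2 * (|v 0| + |v 1|) * (|w 0| + |w 1|)) * (m : ℝ) := by
      intro m hm
      have h1 := (bgm_diff_bounds hS (hmem m hm) ha k).2.2
      have h2 := (bgm_diff_bounds hS (hmem m hm) hna k).2.2
      have e : fderiv ℝ (fderiv ℝ (g m)) k v w =
          fderiv ℝ (fderiv ℝ (fun k => E (-(m : ℤ)) (π / β, k) - E (-(m : ℤ) - 1) (π / β, k))) k v w +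
          fderiv ℝ (fderiv ℝ (fun k => E (-(m : ℤ)) (-(π / β), k) - E (-(m : ℤ) - 1) (-(π / β), k))) k v w :=
        fderiv_fderiv_add_apply' (hdd m _) (hdd m _) k v w
      rw [e]
      have b1 := norm_bilin_apply_le_basis _ h1 v w
      have b2 := norm_bilin_apply_le_basis _ h2 v w
      calc _ ≤ _ + _ := norm_add_le _ _
        _ ≤ _ := by linarith
    calc 1 / 2 * ‖∑ m ∈ Finset.range n, fderiv ℝ (fderiv ℝ (g m)) k v w‖
        ≤ 1 / 2 * ∑ m ∈ Finset.range n, ‖fderiv ℝ (fderiv ℝ (g m)) k v w‖ := by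
          gcongr; exact norm_sum_le _ _
      _ ≤ 1 / 2 * ∑ m ∈ Finset.range n, 2 * (|C 2| * U ^ 2 * (|v 0| + |v 1|) * (|w 0| + |w 1|)) * (m : ℝ) := by
          gcongr with m hm; exact hterm m hm
      _ = |C 2| * U ^ 2 * (|v 0| + |v 1|) * (|w 0| + |w 1|) * ∑ m ∈ Finset.range n, (m : ℝ) := by
          rw [← Finset.mul_sum]; ring
      _ ≤ |C 2| * U ^ 2 * (|v 0| + |v 1|) * (|w 0| + |w 1|) * (n : ℝ) ^ 2 := by
          gcongr; exact sum_range_cast_le_sq n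
      _ = |C 2| * (U * h) ^ 2 * (|v 0| + |v 1|) * (|w 0| + |w 1|) := by rw [hnr]; ring

end EffDisp


/-! ### §C BGM 2006 Lemma 2.1 -/

section Assembly

variable {ε : (Fin 2 → ℝ) → ℝ} {δ₁ δ₂ : ℝ}

/-- **Strong convexity on the disc `|kᵢ| ≤ π/4`**: there `Hess ε₀ = 2 diag(cos k₁, cos k₂) ≥ √2`, and a
`δ₂ ≤ 1/8`-small Hessian perturbation keeps `D²ε(p⃗)(w, w) ≥ |w|²`. [cite: BenfattoGiulianiMastropietro2006, §2.4 proof of Lemma 2.1 p0009:L95–L99] -/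
theorem hessian_lower
    (h2 : ∀ k v w, |fderiv ℝ (fderiv ℝ ε) k v w - fderiv ℝ (fderiv ℝ sqDispersion) k v w| ≤
      δ₂ * (|v 0| + |v 1|) * (|w 0| + |w 1|))
    (hδ₂ : δ₂ ≤ 1 / 8) {p : Fin 2 → ℝ} (hp : ∀ i, |p i| ≤ π / 4) (w : Fin 2 → ℝ) :
    1 * (w 0 ^ 2 + w 1 ^ 2) ≤ fderiv ℝ (fderiv ℝ ε) p w w := by
  have h := (abs_le.1 (h2 p w w)).1
  rw [fderiv_fderiv_sqDispersion_apply] at h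
  have hcos : ∀ i, Real.sqrt 2 / 2 ≤ Real.cos (p i) := fun i => by
    rw [← Real.cos_abs, ← Real.cos_pi_div_four]
    exact Real.cos_le_cos_of_nonneg_of_le_pi (abs_nonneg _) (by linarith [Real.pi_pos]) (hp i)
  have hs2 : (1.4 : ℝ) ≤ Real.sqrt 2 := by
    rw [show (1.4 : ℝ) = Real.sqrt (1.4 ^ 2) by rw [Real.sqrt_sq (by norm_num)]]
    exact Real.sqrt_le_sqrt (by norm_num)
  have h0 := hcos 0; have h1 := hcos 1
  have hsq : (|w 0| + |w 1|) * (|w 0| + |w 1|) ≤ 2 * (w 0 ^ 2 + w 1 ^ 2) := by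
    have := sq_abs (w 0); have := sq_abs (w 1)
    nlinarith [sq_nonneg (|w 0| - |w 1|), abs_nonneg (w 0), abs_nonneg (w 1)]
  have hδ : δ₂ * (|w 0| + |w 1|) * (|w 0| + |w 1|) ≤ 1 / 8 * (2 * (w 0 ^ 2 + w 1 ^ 2)) := by
    have hδ₂0 : 0 ≤ δ₂ := by
      have := (abs_nonneg _).trans (h2 p (Pi.single 0 1) (Pi.single 0 1))
      simpa using this
    rw [mul_assoc]
    exact mul_le_mul hδ₂ hsq (by positivity) (by norm_num)
  nlinarith [sq_nonneg (w 0), sq_nonneg (w 1), mul_nonneg (sub_nonneg.2 h0) (sq_nonneg (w 0)),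
    mul_nonneg (sub_nonneg.2 h1) (sq_nonneg (w 1))]

/-- At `E_0 ≡ ε₀` the scale-`0` effective dispersion is the free band exactly. [folklore] -/
private theorem bgmEffDisp_zero {E : ℤ → ℝ × (Fin 2 → ℝ) → ℂ} (hI : BGMInitial E) (β : ℝ) :
    bgmEffDisp β E 0 = sqDispersion := by
  funext k
  rw [bgmEffDisp, hI, hI]
  have : (((sqDispersion ((π / β, k) : ℝ × (Fin 2 → ℝ)).2 : ℝ) : ℂ) +
      ((sqDispersion ((-(π / β), k) : ℝ × (Fin 2 → ℝ)).2 : ℝ) : ℂ)) / 2 = ((sqDispersion k : ℝ) : ℂ) := by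
    push_cast; ring
  rw [this, Complex.ofReal_re]

end Assembly

/-- **BGM 2006 Lemma 2.1 — PROVED** (discharge of the named fact `BGM2006_Lemma_2_1`, FACT-LIST F-001 of
the cell gate-hubbard-kl): under (2.36) for `h_β ≤ h ≤ 0`, `|U| ≤ U₀` and `c₀ = |h_β|U₀` small, the
scale-`h` Fermi curves `Σ^{(h)}(e)`, `|e| ≤ ē = e₀/2`, are `C²` convex polar graphs around the origin,
symmetric under reflection, with `u_h ≥ c`, curvature `≥ c`, radial transversality
`c₁ ≤ ∇ε_h·e⃗_r ≤ c₂`, and no umklapp for `2n ≤ 8` momenta.  Proof as printed: the telescoped (2.36)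
gives (2.41a) (`bgmEffDisp_perturbation`); the ray equation is inverted by the implicit function
private theorem (`contDiffAt_levelRadius_uncurry`); convexity from the second derivatives
(`le_polarCurvature_of_hessian`); (2.40a) from the Euclidean radius bound `|k⃗| ≤ arccos(-L/2 - 1) < π/4`
(`sqrt_sq_add_sq_le_umklappRadius`). [cite: BenfattoGiulianiMastropietro2006, §2.4 Lemma 2.1 and its proof p0009:L39–L99] -/
theorem BGM2006_Lemma_2_1_holds : BGM2006_Lemma_2_1 := by
  intro μ e₀ hμ₁ hμ₂ he₀ C
  obtain ⟨he₀pos, he₀hi, he₀lo⟩ := he₀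
  have hπ3 := Real.pi_gt_three
  have hπ4 := Real.pi_lt_four
  -- constants
  set K₀ := |C 0| with hK₀
  set K₁ := |C 1| with hK₁
  set K₂ := |C 2| with hK₂
  have hK₀0 : 0 ≤ K₀ := abs_nonneg _
  have hK₁0 : 0 ≤ K₁ := abs_nonneg _
  have hK₂0 : 0 ≤ K₂ := abs_nonneg _
  set c := Real.sqrt e₀ / 2 with hc
  have hcpos : 0 < c := by rw [hc]; positivity
  have hcsq : c ^ 2 = e₀ / 4 := by rw [hc, div_pow, Real.sq_sqrt he₀pos.le]; norm_num
  have hc_half : c < 1 / 2 := by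
    have he1 : e₀ < 1 := by
      have : (1.4 : ℝ) ≤ Real.sqrt 2 := by
        rw [show (1.4 : ℝ) = Real.sqrt (1.4 ^ 2) by rw [Real.sqrt_sq (by norm_num)]]
        exact Real.sqrt_le_sqrt (by norm_num)
      linarith
    have : Real.sqrt e₀ < 1 := by
      rw [← Real.sqrt_one]; exact Real.sqrt_lt_sqrt he₀pos.le he1
    rw [hc]; linarith
  set c₀ := min 1 (min (e₀ / (16 * (K₀ + 1))) (min (c / (4 * (K₁ + 1))) (1 / (8 * (K₂ + 1))))) with hc₀
  have hc₀pos : 0 < c₀ := by rw [hc₀]; positivity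
  have hc₀1 : c₀ ≤ 1 := by rw [hc₀]; exact min_le_left _ _
  have hc₀a : c₀ ≤ e₀ / (16 * (K₀ + 1)) := by
    rw [hc₀]; exact (min_le_right _ _).trans (min_le_left _ _)
  have hc₀b : c₀ ≤ c / (4 * (K₁ + 1)) := by
    rw [hc₀]; exact (min_le_right _ _).trans ((min_le_right _ _).trans (min_le_left _ _))
  have hc₀c : c₀ ≤ 1 / (8 * (K₂ + 1)) := by
    rw [hc₀]; exact (min_le_right _ _).trans ((min_le_right _ _).trans (min_le_right _ _))
  have hc₀sq : c₀ ^ 2 ≤ c₀ := by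
    calc c₀ ^ 2 = c₀ * c₀ := sq c₀
      _ ≤ c₀ * 1 := mul_le_mul_of_nonneg_left hc₀1 hc₀pos.le
      _ = c₀ := mul_one _
  -- the uniform perturbation sizes
  set δ₀ := 2 * K₀ * c₀ with hδ₀
  set δ₁ := 2 * K₁ * c₀ ^ 2 with hδ₁
  set δ₂ := K₂ * c₀ ^ 2 with hδ₂
  have hδ₀0 : 0 ≤ δ₀ := by rw [hδ₀]; positivity
  have hδ₁0 : 0 ≤ δ₁ := by rw [hδ₁]; positivity
  have hδ₂0 : 0 ≤ δ₂ := by rw [hδ₂]; positivity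
  have hδ₀e : δ₀ ≤ e₀ / 8 := by
    have h1 : K₀ * c₀ ≤ K₀ * (e₀ / (16 * (K₀ + 1))) := mul_le_mul_of_nonneg_left hc₀a hK₀0
    have h2 : K₀ * (e₀ / (16 * (K₀ + 1))) ≤ e₀ / 16 := by
      rw [show K₀ * (e₀ / (16 * (K₀ + 1))) = e₀ / 16 * (K₀ / (K₀ + 1)) by field_simp]
      exact mul_le_of_le_one_right (by positivity) (div_le_one_of_le₀ (by linarith) (by positivity))
    rw [hδ₀]; linarith
  have hδ₁c : 2 * δ₁ ≤ c := by
    have h1 : (K₁ + 1) * c₀ ≤ (K₁ + 1) * (c / (4 * (K₁ + 1))) :=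
      mul_le_mul_of_nonneg_left hc₀b (by positivity)
    have h2 : (K₁ + 1) * (c / (4 * (K₁ + 1))) = c / 4 := by field_simp
    have h3 : K₁ * c₀ ^ 2 ≤ K₁ * c₀ := mul_le_mul_of_nonneg_left hc₀sq hK₁0
    have h4 : K₁ * c₀ ≤ (K₁ + 1) * c₀ := by linarith [hc₀pos.le]
    rw [hδ₁]; linarith
  have hgap : 2 * δ₁ < 4 / π * c := by
    have : c < 4 / π * c := by
      rw [lt_mul_iff_one_lt_left hcpos, lt_div_iff₀ Real.pi_pos]; linarith
    linarith
  have hδ₁q : δ₁ ≤ 1 / 4 := by linarith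
  have hδ₂e : δ₂ ≤ 1 / 8 := by
    have h1 : (K₂ + 1) * c₀ ≤ (K₂ + 1) * (1 / (8 * (K₂ + 1))) :=
      mul_le_mul_of_nonneg_left hc₀c (by positivity)
    have h2 : (K₂ + 1) * (1 / (8 * (K₂ + 1))) = 1 / 8 := by field_simp
    have h3 : K₂ * c₀ ^ 2 ≤ K₂ * c₀ := mul_le_mul_of_nonneg_left hc₀sq hK₂0
    have h4 : K₂ * c₀ ≤ (K₂ + 1) * c₀ := by linarith [hc₀pos.le]
    rw [hδ₂]; linarith
  -- the output constants
  set c₁ := 4 / π * c - 2 * δ₁ with hc₁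
  have hc₁pos : 0 < c₁ := by rw [hc₁]; linarith
  have hc₁5 : c₁ ≤ 5 := by
    have : 4 / π * c ≤ 4 / 3 * c := by
      apply mul_le_mul_of_nonneg_right _ hcpos.le
      rw [div_le_div_iff₀ Real.pi_pos (by norm_num)]; linarith
    rw [hc₁]; linarith
  clear_value K₀ K₁ K₂ c c₀ δ₀ δ₁ δ₂ c₁
  refine ⟨c₀, e₀ / 2, min c (1 / 5), c₁, 5, hc₀pos, by positivity, lt_min hcpos (by norm_num), hc₁pos,
    hc₁5, ?_⟩
  intro β U₀ U hβ hβpos hhβ hU hcU E hI hSym hS h hh₁ hh₀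
  -- ε_h is `C²`-close to ε₀ with the UNIFORM sizes δ₀, δ₁, δ₂
  have H : ContDiff ℝ 2 (bgmEffDisp β E h) ∧
      (∀ k, |bgmEffDisp β E h k - sqDispersion k| ≤ δ₀) ∧
      (∀ k v, |fderiv ℝ (bgmEffDisp β E h) k v - fderiv ℝ sqDispersion k v| ≤ δ₁ * (|v 0| + |v 1|)) ∧
      (∀ k v w, |fderiv ℝ (fderiv ℝ (bgmEffDisp β E h)) k v w - fderiv ℝ (fderiv ℝ sqDispersion) k v w| ≤
        δ₂ * (|v 0| + |v 1|) * (|w 0| + |w 1|)) := by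
    rcases eq_or_lt_of_le hhβ with hβ0 | hβlt
    · -- `h_β = 0`: then `h = 0` and `ε_0 = ε₀` exactly
      have h0 : h = 0 := le_antisymm hh₀ (by rw [← hβ0]; exact hh₁)
      rw [h0, bgmEffDisp_zero hI β]
      refine ⟨contDiff_sqDispersion, fun k => ?_, fun k v => ?_, fun k v w => ?_⟩
      · rw [sub_self, abs_zero]; exact hδ₀0
      · rw [sub_self, abs_zero]; positivity
      · rw [sub_self, abs_zero]; positivity
    · -- `h_β ≤ -1`: `|U| ≤ U₀ ≤ c₀` and `|U h| ≤ U₀|h_β| ≤ c₀`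
      have hβ1 : (1 : ℝ) ≤ |(hβ : ℝ)| := by
        rw [abs_of_nonpos (by exact_mod_cast hhβ)]
        have : (hβ : ℝ) ≤ -1 := by exact_mod_cast (show hβ ≤ -1 by omega)
        linarith
      have hU₀ : 0 ≤ U₀ := (abs_nonneg U).trans hU
      have hUc : |U| ≤ c₀ := by
        calc |U| ≤ U₀ := hU
          _ = 1 * U₀ := (one_mul _).symm
          _ ≤ |(hβ : ℝ)| * U₀ := mul_le_mul_of_nonneg_right hβ1 hU₀
          _ ≤ c₀ := hcU
      have hUh : |U * (h : ℝ)| ≤ c₀ := by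
        rw [abs_mul]
        have hh' : |(h : ℝ)| ≤ |(hβ : ℝ)| := by
          rw [abs_of_nonpos (by exact_mod_cast hh₀), abs_of_nonpos (by exact_mod_cast hhβ)]
          exact_mod_cast neg_le_neg hh₁
        calc |U| * |(h : ℝ)| ≤ U₀ * |(hβ : ℝ)| := mul_le_mul hU hh' (abs_nonneg _) hU₀
          _ = |(hβ : ℝ)| * U₀ := mul_comm _ _
          _ ≤ c₀ := hcU
      obtain ⟨hd, h0, h1, h2⟩ := bgmEffDisp_perturbation hI hS hh₁ hh₀
      refine ⟨hd, fun k => (h0 k).trans ?_, fun k v => (h1 k v).trans ?_,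
        fun k v w => (h2 k v w).trans ?_⟩
      · rw [hδ₀, hK₀]
        exact mul_le_mul_of_nonneg_left hUc (by positivity)
      · have hU2 : U ^ 2 ≤ c₀ ^ 2 := by
          rw [← sq_abs U]; exact pow_le_pow_left₀ (abs_nonneg U) hUc 2
        rw [hδ₁, hK₁]
        exact mul_le_mul_of_nonneg_right (mul_le_mul_of_nonneg_left hU2 (by positivity)) (by positivity)
      · have hU2 : (U * h) ^ 2 ≤ c₀ ^ 2 := by
          rw [← sq_abs (U * h)]; exact pow_le_pow_left₀ (abs_nonneg _) hUh 2
        rw [hδ₂, hK₂]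
        calc |C 2| * (U * ↑h) ^ 2 * (|v 0| + |v 1|) * (|w 0| + |w 1|)
            = |C 2| * (U * ↑h) ^ 2 * ((|v 0| + |v 1|) * (|w 0| + |w 1|)) := by ring
          _ ≤ |C 2| * c₀ ^ 2 * ((|v 0| + |v 1|) * (|w 0| + |w 1|)) := by gcongr
          _ = _ := by ring
  obtain ⟨hεd, h0, h1, h2⟩ := H
  -- the admissible levels contain `[μ - ē, μ + ē]`
  have hlev : ∀ e : ℝ, |e| ≤ e₀ / 2 → μ + e ∈ Ioo (c ^ 2 + δ₀ - 4) (-2 - Real.sqrt 2 - δ₀) := by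
    intro e he
    have h := abs_le.1 he
    rw [hcsq]
    exact ⟨by linarith, by linarith⟩
  -- common facts at an admissible level
  have hB : ∀ e θ : ℝ, |e| ≤ e₀ / 2 →
      IsLevelRadius (bgmEffDisp β E h) (μ + e) θ (levelRadius (bgmEffDisp β E h) (μ + e) θ) ∧
      c ≤ levelRadius (bgmEffDisp β E h) (μ + e) θ ∧
      levelRadius (bgmEffDisp β E h) (μ + e) θ ≤ umklappRadius (μ + e + δ₀) ∧
      umklappRadius (μ + e + δ₀) < π / 4 := fun e θ he =>
    levelRadius_bounds hεd h0 hδ₁0 hgap (hlev e he) θ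
  -- gradient data at a curve point
  have hgrad : ∀ e θ : ℝ, |e| ≤ e₀ / 2 →
      c₁ ≤ fderiv ℝ (bgmEffDisp β E h) (levelRadius (bgmEffDisp β E h) (μ + e) θ • dir θ) (dir θ) ∧
      fderiv ℝ (bgmEffDisp β E h) (levelRadius (bgmEffDisp β E h) (μ + e) θ • dir θ) (dir θ) ≤ 5 / 2 ∧
      |fderiv ℝ (bgmEffDisp β E h) (levelRadius (bgmEffDisp β E h) (μ + e) θ • dir θ) (dirPerp θ)| ≤
        5 / 2 := by
    intro e θ he
    obtain ⟨hu, hcu, huK, hK⟩ := hB e θ he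
    have hge := fderiv_ray_dir_ge h1 hδ₁0 hu.1.1 hu.1.2 θ
    have hle := fderiv_ray_dir_le h1 hδ₁0 hu.1.1 hu.1.2 θ
    have hpe := abs_fderiv_ray_dirPerp_le h1 hδ₁0 hu.1.1 θ
    have : 4 / π * c ≤ 4 / π * levelRadius (bgmEffDisp β E h) (μ + e) θ :=
      mul_le_mul_of_nonneg_left hcu (by positivity)
    refine ⟨by rw [hc₁]; linarith, by linarith, by linarith⟩
  refine ⟨fun e he => ⟨?_, ?_, ?_, ?_, ?_, ?_⟩, fun e θ he => ?_, fun e he n hn k hk => ?_⟩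
  · -- (1) `u ∈ C²`
    exact contDiff_levelRadius (n := 2) hεd le_rfl h0 h1 hδ₁0 hgap (hlev e he)
  · -- (1) reflection symmetry
    exact fun θ => levelRadius_bgmEffDisp_add_pi hSym β h (μ + e) θ
  · -- (1) the polar radius solves the ray equation
    exact fun θ => (hB e θ he).1
  · -- (1) the level set in `[-π, π]²` is the polar graph
    intro k hk
    constructor
    · intro hke
      obtain ⟨-, -, -, hK⟩ := hB e 0 he
      have hL : μ + e + δ₀ < -2 := by
        have := (hlev e he).2; linarith [Real.sqrt_nonneg 2]
      have hr := sqrt_sq_add_sq_le_of_level h0 hL (abs_le_pi_of_mem_zoneSq hk) hke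
      have hkt : k = Real.sqrt (k 0 ^ 2 + k 1 ^ 2) • dir (polarAngle k) := by
        rw [sqrt_sq_add_sq_eq_norm_momToComplex]; exact polar_repr k
      have hroot : IsLevelRadius (bgmEffDisp β E h) (μ + e) (polarAngle k) (Real.sqrt (k 0 ^ 2 + k 1 ^ 2)) :=
        ⟨⟨Real.sqrt_nonneg _, by linarith [Real.pi_pos]⟩, by rw [← hkt]; exact hke⟩
      refine ⟨polarAngle k, ?_⟩
      rw [← eq_levelRadius_of_isLevelRadius hεd h0 h1 hδ₁0 hgap (hlev e he) hroot]
      exact hkt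
    · rintro ⟨θ, rfl⟩
      exact (hB e θ he).1.2
  · -- (1) `u ≥ c`
    exact fun θ => (min_le_left _ _).trans (hB e θ he).2.1
  · -- (1) convexity: `1/r ≥ c`
    intro θ
    refine (min_le_right _ _).trans ?_
    obtain ⟨hu, hcu, huK, hK⟩ := hB e θ he
    obtain ⟨ha1, ha2, hb⟩ := hgrad e θ he
    have hupos : 0 < levelRadius (bgmEffDisp β E h) (μ + e) θ := hcpos.trans_le hcu
    have hapos : 0 < fderiv ℝ (bgmEffDisp β E h) (levelRadius (bgmEffDisp β E h) (μ + e) θ • dir θ) (dir θ) :=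
      hc₁pos.trans_le ha1
    have hab : fderiv ℝ (bgmEffDisp β E h) (levelRadius (bgmEffDisp β E h) (μ + e) θ • dir θ) (dir θ) ^ 2 +
        fderiv ℝ (bgmEffDisp β E h) (levelRadius (bgmEffDisp β E h) (μ + e) θ • dir θ) (dirPerp θ) ^ 2 ≤
          5 ^ 2 := by
      have hb' := abs_le.1 hb
      have hsa : fderiv ℝ (bgmEffDisp β E h) (levelRadius (bgmEffDisp β E h) (μ + e) θ • dir θ) (dir θ) ^ 2
          ≤ (5 / 2) ^ 2 := pow_le_pow_left₀ hapos.le ha2 2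
      have hsb : fderiv ℝ (bgmEffDisp β E h) (levelRadius (bgmEffDisp β E h) (μ + e) θ • dir θ) (dirPerp θ) ^ 2
          ≤ (5 / 2) ^ 2 := sq_le_sq' hb'.1 hb'.2
      linarith
    have h := le_polarCurvature_of_hessian (lam := 1) (M := 5) hεd
      (contDiff_levelRadius (n := 2) hεd le_rfl h0 h1 hδ₁0 hgap (hlev e he))
      (fun ϑ => (hB e ϑ he).1.2) one_pos (by norm_num) hupos hapos hab fun w =>
        hessian_lower h2 hδ₂e (fun i => (abs_smul_dir_apply_le' hu.1.1 θ i).trans (by linarith)) w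
    linarith
  · -- (2) radial transversality
    obtain ⟨ha1, ha2, -⟩ := hgrad e θ he
    exact ⟨ha1, by linarith⟩
  · -- (3) no umklapp for `2n ≤ 8` momenta on the curve
    have hL : μ + e + δ₀ < -2 := by
      have := (hlev e he).2; linarith [Real.sqrt_nonneg 2]
    have hK : umklappRadius (μ + e + δ₀) < π / 4 := (hB e 0 he).2.2.2
    have hR : ∀ j, Real.sqrt (k j 0 ^ 2 + k j 1 ^ 2) ≤ umklappRadius (μ + e + δ₀) := fun j =>
      sqrt_sq_add_sq_le_of_level h0 hL (abs_le_pi_of_mem_zoneSq (hk j).1) (hk j).2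
    have hsum := sqrt_sq_sum_le k hR
    have hn8 : ((2 * n : ℕ) : ℝ) ≤ 8 := by exact_mod_cast (show 2 * n ≤ 8 by omega)
    have hK0 : 0 ≤ umklappRadius (μ + e + δ₀) := umklappRadius_nonneg _
    calc Real.sqrt ((∑ j, k j 0) ^ 2 + (∑ j, k j 1) ^ 2)
        ≤ (2 * n : ℕ) * umklappRadius (μ + e + δ₀) := hsum
      _ ≤ 8 * umklappRadius (μ + e + δ₀) := mul_le_mul_of_nonneg_right hn8 hK0
      _ < 8 * (π / 4) := by gcongr
      _ = 2 * π := by ring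

end Literature.MathematicalPhysics.QuantumLattice.FermiRG

end
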